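import Literature.Barriers.SmoothPoincare4.GaugeInvariantsBlindProofs
import Literature.Barriers.SmoothPoincare4.GluckTwistsDissolveProofs

/-!
# SmoothPoincare4 — barrier catalogue (`BARRIERS.md`)

Summit `SmoothPoincare4` (single conjunct; Statement `Summits/SmoothPoincare4/SmoothPoincare4/Statement.lean`,
decl `SmoothPoincare4` = every Hausdorff, second-countable, `C^∞` 4-manifold `M ≃ₕ S⁴` is diffeomorphic to `𝕊 4`).
Compiled 2026-08-16 by `planner-barriers-SmoothPoincare4-l1-0`; refreshed 2026-08-17 by `planner-barriers-SmoothPoincare4-l1-g2-0`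
(unit `barriers-SmoothPoincare4-l1-g2`, mode `barrier-catalogue`, re-armed daily) from:

* the negatives index — `ledger negatives --problem SmoothPoincare4` = **0 refuted statement items** (unchanged 2026-08-17;
  `run/shared/priority/refutations.json` does not exist on this hub) — every negative result below is a NEGATIVE LEMMA, a hardness /
  position certificate, a NEGATIVE-LEMMA HOLD (`H → ¬ Decl` with `H` not yet constructible) or a route close, never a `closed_as: refuted` item;
* the catalogued literature barriers `lean/Literature/Barriers/SmoothPoincare4/*.lean` (112 files: 16 barrier Props carrying a `BARRIER (D-0021)`
  block, 2 NARROW audit companions, the Aranda–Zupan genus-three fact file, the rest proofs / calibration) — **§A, 17 entries** (A17 new; A1, A3,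
  A11, A13, A14 re-audited 2026-08-16/17: A11 and A14 NARROWED, A3's killed class ENLARGED, A14's gen-1 "Kills" line CORRECTED);
* every landed crux-level negative lemma `lean/Summits/SmoothPoincare4/SmoothPoincare4/Theorems/<Crux>/Negative/*.lean`
  (202 files over 46 cruxes) plus the checked disprover work files `Cruxes/<Crux>/Disproof.lean` — **§B, 47 entries** (B29–B47 new: routes
  `VerlindeRLinks`, `WeakReductionDescent`, `SblfDescent`, `DottedCircleRasmussen`, `DiophantineRotations`, `InformationMetricHadamard` /
  `EinsteinBulk`, `SullivanDual`, `EntropyRung` (`ConicalGap`), `RicciFat`, `TropicalFanoSkeleton`);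
* route-level deaths, in-tree refutations of vendored statements and the dead-line register of the crux workfiles — **§C, 10 entries**.

**74 entries in total** (gen-1: 53). In-tree copy: the module docstring of `lean/Literature/Barriers/SmoothPoincare4/BARRIERS.lean` — the
gate's target classes admit neither markdown nor any file directly under `Summits/SmoothPoincare4/` (`ledger propose --dry-run`, 2026-08-17:
"target must be `Literature/<Topic>/<Subtopic>/….lean | Summits/<P>/Statement.lean | Summits/<P>/Theorems/<Name>.lean`"; `kit` has no `propose`
verb), so the requested `lean/Summits/SmoothPoincare4/BARRIERS.md` lives here; seat copy `BARRIERS.md` in the seat folder. §D lists the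
cross-cutting no-go PATTERNS that recur across §B (read it before filing any crux of the shape `∀ M ≃ₕ S⁴, P M → M ≅ S⁴`), §E is an index
(decl → entry, technique class → entries, route → entries).

## 0. How to read and use this file

* **Per entry**: `Decl` (fully qualified Lean name; for §B the namespace is always
  `Summit.SmoothPoincare4.SmoothPoincare4.Theorems.<Crux>.Negative[.<SubNs>]` and only short names are printed), `File`,
  **Statement** (exact: words + the Lean form), **Status** (theorem / theorem relative to a named fact `(h : X)` / conditional),
  **Kills** (the technique class or the class of route statements it refutes), **Escape** (the hypothesis or restatement that
  evades it — "none" when the entry is a theorem about all members of a class), **Caveats**, **Threatens** (open routes / cruxes).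
* **Ideators / plan-novel**: your card's `## Barriers` section must name every §A decl whose technique class contains your lever
  and say how the lever falls OUTSIDE the class (or "it does not; the bet is …"). If your thesis or a crux is of the shielded shape
  of §D.1, say so explicitly — it cannot be refuted short of an exotic `S⁴`, which is informative for staffing but means no cheap
  falsifier exists on the hypothesis side.
* **Planners typing cruxes**: run §D.2 (junk witnesses) and §D.3 (load-bearing deletions already certified) over every signature;
  the same empty-manifold / `S⁴ ⊔ S⁴` / `ℝℙ⁴` / `ℂℙ²` / Gaussian-shrinker witnesses have killed a dozen weakenings here.
* **Refuters**: §B tells you, per crux, what is already certified (do not re-derive), which strengthenings are dead, and where the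
  standing disprover's work file lives (`Cruxes/<Crux>/Disproof.lean`).
* Negative knowledge that is NOT a barrier (route retired `not-a-thesis`, cards declined) is listed in §C only when it carries a
  mathematical reason.

### 0.1 One-screen summary

| § | id | barrier (short) | decl / file | kills | status |
|---|----|-----------------|-------------|-------|--------|
| A | A1 | TOP invariants blind on homotopy 4-spheres (Freedman) | `TopologicalBarrierFour` | any homeomorphism-invariant detector of exotic `S⁴` | thm rel. Freedman |
| A | A2 | gauge invariants undefined/forced (`b₂⁺ = 0`, sum-stability) | `GaugeSumBarrierFour` | SW/Donaldson/`τ`/`s♯` detectors, on `Σ` or `Y # Σ` | thm (fact discharged) |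
| A | A3 | stable (`S²×S²`) invariants blind, incl. semisimple 4d TFTs | `StableBarrierFour` | stable-diffeo-class invariants | thm rel. `Θ₄ = 0` |
| A | A4 | h-cobordism-class invariants blind, incl. unitary TQFTs | `HCobordismInvariantBarrierFour` | h-cobordism invariants | thm rel. `Θ₄ = 0` |
| A | A5 | smooth h-cobordism theorem fails in dim 4 (Donaldson) | `HCobordismBarrierFour` | h-cobordism ⇒ diffeo programme | thm rel. Donaldson fact |
| A | A6 | twisted spheres `D⁴ ∪_φ D⁴` are standard (Cerf, `Γ₄ = 0`) | `TwistedSphereBarrierFour` | exotic-sphere-by-clutching constructions | thm rel. Cerf fact |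
| A | A7 | Gluck twists dissolve in `ℂℙ²`; `ℂℙ²`-cancellative invariants and the FGMW `s`-strategy blind on them | `GluckTwistCP2Barrier`, `rasmussen_eq_zero_of_isSliceDiscIn_gluckTwist` | `ℂℙ²`-stable detectors; `s`-witness in a Gluck twist | thm (dissolution discharged); MMSW Cor 1.13 named fact |
| A | A8 | worked-out Cappell–Shaneson spheres are standard (Akbulut, Gompf) | `CappellShanesonFamilyBarrier`, `CappellShanesonSmallEntryBarrier` | CS-sphere counterexamples from `Aₘ` / Gompf's classes | thm rel. Akbulut–Gompf facts |
| A | A9 | homotopy 4-spheres with a circle action are standard (Fintushel–Pao + Perelman) | `CircleActionBarrierFour` | `S¹`-symmetric constructions of exotica | thm rel. FP fact |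
| A | A10 | low-genus trisections (`g ≤ 2`, or some `kᵢ ≥ g−1`) carry no exotic `S⁴` | `LowGenusTrisectionBarrier`, `LargeKTrisectionBarrier` | small-genus trisection counterexamples | thm rel. MZ/MSZ facts |
| A | A11 (narrowed) | `b₂`-graded rigidity fails from `b₂ = 3` (Akhmedov–Park) | `SmallExoticaBarrier` | proofs of SPC4 via `SimplyConnectedRigidityUpTo k`, `k ≥ 3` | thm rel. AP fact |
| A | A12 | compact contractible analogue fails: corks (relative) and Akbulut–Ruberman (absolute) | `RelativeContractibleBarrierFour`, `ContractibleBarrierFour` | boundary-extension / homeo⇒diffeo arguments for contractible 4-manifolds | thm rel. facts |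
| A | A13 | one stabilisation is not enough for contractible 4-manifolds (Kang) | `OneStabilisationBarrier` | uniform one-`S²×S²` arguments at cork level | thm rel. Kang fact |
| A | A14 (narrowed) | open analogue fails inside `S⁴`: small exotic `ℝ⁴`'s (DeMichelis–Freedman) | `OpenAnalogueBarrierFour` | "open `ℝ⁴`-homeomorph in standard space is standard" arguments | thm rel. spc4.S11 (= fact) |
| A | A15 | `ℤ/2`-equivariant strengthening fails: exotic free involutions / fake `ℝℙ⁴` | `ProjectiveRigidityBarrierFour` | proofs natural under free `ℤ/2`-actions | thm rel. fact |
| A | A16 | printed Property 2R ⇒ Andrews–Curtis triviality of GST presentations (conditional no-go) | `StrictPropertyTwoRBarrier` | SPC4 via strict (Generalised) Property R | conditional on `AKPresentationsACNontrivial` |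
| A | A17 | weakly reducible genus-3 trisections of a homotopy 4-sphere are standard (Aranda–Zupan 2025) | `az2025_weaklyReducible_genusThree_homotopySphere_gk` | genus-3 weakly-reducible diagram counterexamples; grounds `GenusThreeBase` | named fact (SPC4-implied); reducible branch discharged mod MSZ |
| B | B1–B47 | crux-level certified no-gos (load-bearing hypotheses, refuted weakenings/strengthenings/stubs, "a kill is an exotic `S⁴`", cruxes certified ≡ SPC4, negative-lemma holds) | `Theorems/<Crux>/Negative/*` | see §B | theorems |
| C | C1–C10 | route deaths / vendoring refutations / dead-line register (GluckLasagna detector, LogCYSkeleton NonMax, misstated facts, saturated lines, …) | ledger + route + crux workfiles | see §C | recorded |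

---

## A. Catalogued literature barriers — `lean/Literature/Barriers/SmoothPoincare4/`

All decls below live in namespace `Literature.Barriers.SmoothPoincare4`. "rel. `X`" = proved as `theorem …_of_… (h : X) : Barrier`
with `X` a cite-tagged named fact (D-0014); "discharged" = `X_holds` exists in tree. Binder conventions: closed smooth 4-manifold =
`(M : Type) [TopologicalSpace M] [T2Space M] [SecondCountableTopology M] [ChartedSpace (𝔼 4) M] [IsManifold (𝓡 4) ∞ M] [CompactSpace M]`.

### A1 · `TopologicalBarrierFour` — invariants of the underlying topological manifold cannot detect an exotic 4-sphere
* File `TopologicalInvariantsBlind.lean` (+ `TopologicalInvariantsBlindProofs.lean`: exact strength).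
* **Statement.** For every value type `α` and every `I : ∀ (M : Type) [TopologicalSpace M] [ChartedSpace (𝔼 4) M], α` with
  `IsHomeomorphismInvariant I` (equal on homeomorphic closed smooth 4-manifolds), every closed smooth `S` with `Nonempty (S ≃ₕ 𝕊 4)`
  has `I S = I (𝕊 4)`. Lean: `def TopologicalBarrierFour : Prop := ∀ α I, IsHomeomorphismInvariant I → ∀ S …, Nonempty (S ≃ₕ 𝕊 4) → I S = I (𝕊 4)`.
* **Status.** `topologicalBarrierFour_of_freedman (hF : Literature.Topology.FourManifolds.nonempty_homeomorph_sphere_four)` (Freedman 1982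
  Thm 1.6 / FQ Cor 7.1B; named fact, not discharged). Also `existsExoticFourSphere_iff_of_freedman`: relative to Freedman,
  `ExistsExoticFourSphere` ⇔ "homotopy equivalent, not diffeomorphic" — all difficulty is smooth.
* **Kills.** Refuting SPC4 by any detector computed from the TOP manifold: homotopy type, (co)homology, intersection form, `ks`,
  TOP h-cobordism, s-cobordism and surgery invariants; topological concordance invariants of knots as slice-in-homotopy-ball obstructions
  (used in B27 `crux_topologicalWitness_false`).
* **Escape.** None inside TOP; every approach must use the smooth structure (gauge theory — see A2; Khovanov-type; handle-by-handle).
* **Caveats.** Exactly as strong as Freedman's theorem (audit 2026-08-16 CONFIRMED: `topologicalBarrierFour_iff` — the barrier ⇔ the smooth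
  case of FQ Cor 7.1B, in every universe); carries no heuristic weight either way (in dim 7 exotic spheres exist and are detected only
  smoothly; in dims 5, 6, 12, 56, 61 there are none). Scope: (d) the QUASICONFORMAL / LIPSCHITZ categories are strictly finer than TOP in
  dimension 4 (Donaldson–Sullivan 1989 Thm 2) — an invariant of the bi-Lipschitz or QC structure only is NOT in the class (this is the bet of
  the DRAFT route `LipschitzHauptvermutung`); (e) relative / equivariant topological data (pairs, group actions) are outside the class too.
* **Threatens / cited by.** Essentially every open route cites it (all positive routes trivially evade it: they prove, not detect).

### A2 · `GaugeSumBarrierFour` — gauge-theoretic invariants are undefined or forced on homotopy 4-spheres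
* File `GaugeInvariantsBlind.lean` (+ `GaugeInvariantsBlindProofs.lean`: discharge).
* **Statement.** Technique class `IsHomotopySphereSumStable I`: `I P = I Y` whenever `P` is a connected sum (`IsConnectedSum`,
  orientation-free) of `Y` with a closed smooth `Σ ≃ₕ S⁴` (what KMT 1995 Remark 1 prints for `SW` on `b₂⁺(Y) > 1`). Barrier:
  for every such `I`, every closed smooth `Σ ≃ₕ S⁴` and every closed smooth `Y`: (1) any connected sum of `Y` with `Σ` and any of `Y`
  with `S⁴` have equal `I`; (2) `I Σ = I S⁴`. Anchor `isZero_singularHomologyZ_two_of_homotopyEquiv`: a closed `M ≃ₕ S⁴` has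
  `H₂(M;ℤ) = 0`, so `b₂⁺ = 0` — outside the domain of `SW` (Morgan Thm 6.7.3, §6.9).
* **Status.** THEOREM: `gaugeSumBarrierFour_of_sphere_self (hself : isConnectedSum_sphere_self)` and `isConnectedSum_sphere_self_holds`
  is in tree (`Literature/Topology/FourManifolds/ConnectedSumSphereIdentity.lean`); unconditional form `GaugeSumBarrierFour_holds`
  (`GaugeInvariantsBlindProofs.lean`).
* **Kills.** Refuting SPC4 by (i) evaluating SW/Donaldson on `Σ` (undefined, `b₂⁺ = 0`) or a gauge invariant that IS defined at
  `b₂⁺ = 0` (forced: the Bauer–Furuta class `[μ_Σ]` is the identity, Bauer 2004 Prop 4.1; `λ_SW(S¹ × S³ # Σ) = 0 = λ_SW(S¹ × S³)`,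
  MRS 2011 / LRS 2018 Thm 1 with `HM_red(S³) = 0`); (ii) comparing `Y # Σ` with `Y # S⁴` (KMT Remark 1 for `SW`; Bauer 2004 Thm 1.1 /
  Cor 4.2 for `[μ_X]`; Kotschick 1993 = KMT's "[5]" for Donaldson invariants); (iii) the FGMW knot strategy with `τ` or `s♯` in place of
  `s` ("if `K` is slice in any homotopy 4-ball then `τ(K) = 0`", OS 2003 Thm 1.1; KM 2013 Cor 1.1) — cf. B27 `crux_blindWitness_false`.
* **Escape.** None in print inside gauge theory of the CLOSED manifold: the Bauer–Furuta stable cohomotopy invariant is sum-stable and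
  forced on `Σ` (Bauer 2004 Thm 1.1, Prop 4.1, Cor 4.2 with `d = ind D_Σ = 0`; audit 2026-08-16, earlier listed here as an escape).
  Outside the class and uncomputed: `Pin(2)`-equivariant FAMILY Bauer–Furuta invariants of diffeomorphisms / loops (Lin–Mukherjee 2021:
  the `S¹`-equivariant family invariant vanishes for every homologically trivial spin diffeomorphism of every homotopy 4-sphere, Thm 9,
  and for all diffeomorphisms and exotic loops of `S⁴`, Thms 6–7, but a BF-type `α₀ ≠ 0` in `π₁^{Pin(2)}(S⁰)` exists, Thm 8 — aimed at
  `Diff(S⁴)`, not at SPC4); relative Floer invariants of the pieces of `Σ` cut along a 3-manifold `≠ S³`; Rasmussen's `s` (not known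
  to neck-stretch; FGMW) — blocked for Gluck twists (A7) and open in general (`MMSW2023Question911Knot`); skein lasagna modules (not
  gauge-theoretic; but see C1).
* **Caveats.** No printed meta-theorem "all gauge invariants are blind"; the class is for UNORIENTED manifolds in `Type`;
  conclusion (2) is junk=junk for invariants extended by a constant below `b₂⁺ ≤ 1` and informative for `[μ_X]`, `λ_SW`.
  Audited 2026-08-16 (barrier-audit, p128184): every citation confirmed at page level; class enlarged as above.
* **Threatens.** Negative-side routes `ZeroSurgeryExotic` (crux `ZseCruxRasmussen` must use `s`, not `τ`/`s♯`: B27),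
  `DottedCircleRasmussen` (`DcrGap`); any `InstantonEntropy`/`InformationMetricHadamard`-type use of ASD moduli as a DETECTOR
  (those routes use moduli geometrically, on `S⁴`-candidates, which is outside the class only if the output is not a sum-stable number).

### A3 · `StableBarrierFour` — `S² × S²`-stable diffeomorphism invariants (incl. all semisimple oriented 4d TFTs) cannot detect a homotopy 4-sphere
* File `StableInvariantsBlind.lean` (+ `…Proofs`, `…Calibration`, `…Frontier`, `…Parity`, `…ThetaFour`).
* **Statement.** Class `IsStableInvariant I` (constant on `S²×S²`-stable diffeomorphism classes of connected closed smooth 4-manifolds;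
  printed members: every semisimple oriented 4d TFT `Bord₄ → Vect_k`, Reutter 2023 Thm 1, hence all invertible / unitary /
  once-extended ones, and every semisimple TFT with values in `sVect` / any tangential 1-type, `B`-stably (Reutter–Schommer-Pries 2022
  Thm 5.21); `isStableInvariant_of_connectedSum_prod` / `_of_connectedSum_mul`: any diffeo-invariant multiplying under `# S²×S²` by an
  injective map / a LEFT-REGULAR ring element `z` (e.g. the CGHP non-compact (3+1)-TQFT scalar `Ṡ_C` with `Ṡ_C(S²×S²) ≠ 0`,
  Costantino–Geer–Haïoun–Patureau-Mirand, CostantinoEtAl2026 Prop 6.14 / 6.16 / Thm 6.6); closure `IsStableInvariant.postcomp`, `.prod`;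
  corollary form `StableBarrierFour.nonempty_diffeomorph_sphere_of_isStableInvariant`).
  Barrier: `∀ α I, IsStableInvariant I → ∀ S : HomotopySphere 4, I S.carrier = I (𝕊 4)`.
* **Status.** `stableBarrierFour_of_wall (hW : exists_isStabilization_of_isHCobordant) (hΘ : isHCobordant_sphere_of_homotopySphere_four)
  (hS4 : simplyConnectedSpace_sphere_four)`; `hW` (Wall 1964 Thm 3) and `hS4` are discharged (`WallStabilisationProofs.lean`,
  `SphereSimplyConnected.lean`); `Θ₄ = 0` (Kervaire–Milnor) is NOT — `StableInvariantsBlindThetaFour.lean` derives the barrier from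
  `Θ₄ = 0` alone, `…Parity.lean` from `Θ₄ = 0` + oddness of the twisted surgery. CALIBRATION (`…Calibration.lean`,
  `stableBarrierFour_iff_eqvGen`): the barrier is EQUIVALENT to "every homotopy 4-sphere is chain-stably standard" (related to `S⁴`
  by the equivalence relation generated by `HasCommonStabilization`); value universe immaterial (`stableBarrierFour_univ_iff`);
  `IsStableInvariant.isHCobordismInvariant` (given Wall) links it to A4.
* **Kills.** "Construct a 4d TFT sensitive to exotic smooth structure on `S⁴`" — no semisimple theory can (Reutter §1.1); any
  invariant factoring through the stable class.
* **Escape (sharpened by the 2026-08-16 audit: the class is LARGER than printed, the escape NARROWER).** Only `S²×S²`-ZERO-DIVISOR carriers —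
  invariants ANNIHILATED (not multiplied by a regular element) under `# S²×S²` — fall outside: (i) skein lasagna modules (RenWillis2024
  Ex 3.2, Prop 2.4, Thm 1.1: detect some exotic pairs with boundary / `b₂ > 0`; blind over `ℚ` on `ℂℙ²bar`-dissolving homotopy spheres,
  Prop 6.17, and Gluck-invariant, RenEtAl2025 Thm 7.1 — C1); (ii) the Décoppet–Haïoun characteristic-`p` Temperley–Lieb skein invariant
  `Ṡ^{ζ^{1/2}}_{p(2)}` (`p > 3`; Thm B: vanishes on `ℂℙ²`, `ℂℙ²bar`, `S²×S²`; Thm A: no 1-handle attaching map; its diffeomorphism invariance is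
  their open Question E — route `VerlindeRLinks`, B29); (iii) non-compact / non-semisimple (3+1)-TQFTs in general (CostantinoEtAl2026 Thm 6.6) —
  but EVERY computed example is a class member via `_of_connectedSum_mul`. No closed-manifold, `S²×S²`-annihilated, diffeomorphism-invariant
  quantity separating two homeomorphic closed 4-manifolds is in print.
* **Caveats.** Oriented theories over algebraically closed `k`; class stated for unoriented connected manifolds in `Type`; void in
  dimensions `> 4` (exotic spheres there are stably non-diffeomorphic).
* **Threatens.** `Stabilisation` (its conjunct S1 "`Σ # S²×S² ≅ S²×S²`" is the ONE-step form of what every route here gives: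
  consistent with the barrier, not killed by it), `CommonDualRelay`, `GluckLasagna` (closed, C1).

### A4 · `HCobordismInvariantBarrierFour` — invariants of the smooth h-cobordism class (in particular unitary (3+1)-TQFTs) cannot detect a homotopy 4-sphere
* File `HCobordismInvariantsBlind.lean` (+ `…Proofs.lean`: what an unconditional proof must contain).
* **Statement.** Class `IsHCobordismInvariant I` (constant on smooth h-cobordism classes of SIMPLY CONNECTED closed smooth
  4-manifolds; printed members: unitary (3+1)-TQFTs, even with gluing only along homology spheres, FKNSWW 2005 Thms 4.1–4.2; all
  `S²×S²`-stable invariants, Wall Thm 3; all semisimple TFTs). Barrier: `∀ α I, IsHCobordismInvariant I → ∀ S : HomotopySphere 4,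
  I S.carrier = I (𝕊 4)`.
* **Status.** `hCobordismInvariantBarrierFour_of_theta_four (hΘ : isHCobordant_sphere_of_homotopySphere_four)` (`Θ₄ = 0`,
  Kervaire–Milnor Thm 1.1; not discharged). `IsHCobordismInvariant.not_separates`: no such `I` separates any homotopy sphere from `S⁴`.
* **Kills.** Unitary/semisimple TQFT detectors; anything constant on h-cobordism classes (universal-manifold-pairing positivity
  forces `Z(P) = Z(Q)` for h-cobordant 1-connected `P, Q`: CFHS / Matveyev cork decomposition + doubles `≅ S⁴`).
* **Escape.** Non-unitary non-semisimple theories (outside both this entry and Reutter); "the choice of smooth category might be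
  essential" (FKNSWW).
* **Caveats.** Restricted to simply connected closed manifolds; void in dims `≥ 5` (h-cobordant ⇒ diffeomorphic there).
* **Threatens.** Same family as A3; cited by 41 open routes as non-applicable (they do not build invariants).

### A5 · `HCobordismBarrierFour` — the smooth h-cobordism theorem fails in dimension 4
* File `HCobordismTheoremFails.lean` (+ `…Proofs.lean`).
* **Statement.** `HCobordismPrincipleFour := ∀ M N` closed smooth simply connected, `IsHCobordant 4 M N → Nonempty (M ≃ₘ N)`;
  barrier `¬ HCobordismPrincipleFour`. `HCobordismPrincipleFour.nonempty_diffeomorph_sphere`: the principle + `Θ₄ = 0` + `π₁ S⁴ = 1`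
  would prove SPC4; `hCobordismPrinciple_homotopySphere_iff`: RESTRICTED to homotopy 4-spheres the principle is EQUIVALENT to SPC4.
* **Status.** `hCobordismBarrierFour_of_donaldson (hD : exists_isHCobordant_isEmpty_diffeomorph_four)` (Donaldson 1987 Thm (3.24):
  `ℂℙ² # 9ℂℙ²bar` vs Dolgachev; not discharged). `HCobordismPrincipleFour.elim`: ex falso packaging.
* **Kills.** Smale's proof pattern run one dimension too low: "`Σ` h-cobordant to `S⁴` (always) ⇒ `Σ ≅ S⁴`" via a GENERAL
  h-cobordism ⇒ diffeomorphism lemma; complete in dims `≥ 5` (`nonempty_diffeomorph_of_isHCobordant_of_five_le`).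
* **Escape / evasions known.** (i) TOP: the principle holds (Freedman; `Freedman1982_isTopProduct_of_isHCobordism`); (ii) stably it
  holds (Wall Thm 3, `exists_isStabilization_of_isHCobordant`, discharged); (iii) localisation: any such h-cobordism is a product off
  a contractible piece — ends differ by a CORK TWIST (`corkDecomposition`, `Matveyev1996_decomposition`) — this is where routes
  `IsotropicCorkBracketing`, `RicciFat`, `WeylBudget`, `Stabilisation`, `CommonDualRelay`, `ThreePointSpheres` work.
* **Caveats.** Printed counterexamples have `b₂ = 10`; no non-product h-cobordism FROM A HOMOTOPY 4-SPHERE is known (that is SPC4).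
* **Threatens.** Every route whose glue silently uses "h-cobordant simply connected ⇒ diffeomorphic"; `CommonDualRelay`
  (h-cobordism middle level: must supply the common duals, not the principle), `Stabilisation` (S1/S2 one-stabilisation: A13).

### A6 · `TwistedSphereBarrierFour` — twisted 4-spheres are standard (Cerf, `Γ₄ = 0`)
* File `TwistedSpheresStandard.lean` (+ `…Proofs.lean`).
* **Statement.** `ExoticTwistedSphereFour := ∃ φ : 𝕊 3 ≃ₘ 𝕊 3, ∃ P` closed smooth, `IsTwistedSphere 3 φ P ∧ IsEmpty (P ≃ₘ 𝕊 4)`;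
  barrier `¬ ExoticTwistedSphereFour`. `everyHomotopySphereTwisted_iff (hC)`: GIVEN `Γ₄ = 0`, "every homotopy 4-sphere is a twisted
  sphere" ⇔ SPC4.
* **Status.** `twistedSphereBarrierFour_of_cerf (hC : cerf_twistedSphere_four)` (Cerf 1968 `π₀ Diff⁺ S³ = 0`; named fact, not
  discharged; EQUIVALENT to the barrier, `twistedSphereBarrierFour_iff_cerf`). The same fact IS crux `SchoenfliesSplit.SchsplitCerf`
  (B25): a refutation of it is an exotic `S⁴`.
* **Kills.** The dimension-`≥ 6` construction of exotic spheres by clutching `D⁴ ∪_φ D⁴`; any route that reduces SPC4 to "present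
  `Σ` as a twisted sphere" has reduced it to SPC4 itself (no loss, no gain).
* **Escape.** Constructions not presented as `D⁴ ∪_φ D⁴` (Gluck twists use `Diff(S²×S¹)`; CS spheres; 0-surgery homeomorphisms);
  higher homotopy of `Diff(S³)`; diffeomorphisms of other 3-manifolds.
* **Threatens / used by.** `SchoenfliesSplit` (B25), `OrigamiRung` endgame stubs (`twistedSphere_of_smoothPoincare4`, B21),
  `EuclideanOrigami` (Schoenflies finish), `CircularKirby` (CerfDiffSphereThree is a theorem, cannot be refuted).

### A7 · `GluckTwistCP2Barrier` (+ `rasmussen_eq_zero_of_isSliceDiscIn_gluckTwist`, `mmsw2023_sZero_of_dissolvesInCP2`) — Gluck twists dissolve in `ℂℙ²`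
* File `GluckTwistsDissolve.lean` (+ `…ConnectedSumProofs` = discharge of dissolution, `…RasmussenProofs`, `…BeyondGluckProofs`, `…Proofs`).
* **Statements.** (a) Named fact `gluckTwist_connectedSum_complexProjectivePlane`: for every 2-knot `K`, every Gluck twist `X`
  (`IsGluckTwist (𝓡 4) X K`) and every connected sum `P` of `X` with `ComplexProjectivePlane`, `Nonempty (P ≃ₘ ℂℙ²)` — DISCHARGED
  (`gluckTwist_connectedSum_complexProjectivePlane_holds`, `GluckTwistsDissolveConnectedSumProofs.lean`). (b) Class
  `IsCP2Cancellative I` (`I M = I N` as soon as some `M # ℂℙ² ≅ N # ℂℙ²`; contains every one-step `ℂℙ²`-stable invariant,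
  `isCP2Cancellative_of_stable`). Barrier `GluckTwistCP2Barrier : ∀ α I, IsCP2Cancellative I → ∀ K X, IsGluckTwist (𝓡 4) X K → I X = I (𝕊 4)`
  — THEOREM (`gluckTwistCP2Barrier_of_dissolve` + discharged facts; unconditional form `GluckTwistCP2Barrier_holds`, `GluckTwistsDissolveProofs.lean`). (c) Named fact `rasmussen_eq_zero_of_isSliceDiscIn_gluckTwist`
  (MMSW 2023 Cor 1.13, knots): a knot bounding a smooth proper disc in the punctured Gluck twist of any 2-knot has `s = 0`; hence
  `not_fgmwRasmussenStrategyGluck`: the FGMW `s`-strategy cannot succeed on a Gluck twist. NOT discharged (needs Lee-homology cobordism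
  maps; `…RasmussenProofs`: it CONTAINS Rasmussen's slice theorem; equivalent to the one-sided bound `s ≤ 0`). (d) "Beyond Gluck":
  `DissolvesInCP2 X`, named fact `mmsw2023_sZero_of_dissolvesInCP2` (§9.3, `r = 1`): `s = 0` for knots slice in any closed smooth
  homotopy 4-sphere that dissolves in `ℂℙ²`; `not_fgmwRasmussenStrategy_of_cp2Rigid`: `ℂℙ²`-RIGIDITY ON HOMOTOPY-SPHERE SUMS
  (`∀ X ≃ₕ S⁴, DissolvesInCP2 X`) blocks the whole `s`-strategy; `exoticCP2Sum_of_fgmwRasmussenStrategy`: an `s`-witness costs an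
  exotic `ℂℙ²`-sum. Registered OPEN statements: `FGMWRasmussenStrategy` (∃ knot slice in a homotopy ball with `s ≠ 0`),
  `MMSW2023Question911Knot` (its negation: `not_fgmwRasmussenStrategy_iff_question`).
* **Kills.** Refuting `GluckTwistConjecture` / SPC4 by a `ℂℙ²`-cancellative invariant on a Gluck twist; the `s`-invariant slicing
  strategy inside a Gluck twist (route `GluckLasagna`, C1; lever `stub_gluckSliceTransfer` of line `two-knot-meridional-dual` in B28
  — there the barrier is USED positively: lever + Cor 1.13 ⇒ `SVanishesOnPairs`).
* **Escape.** Homotopy spheres NOT arising from Gluck twists and not known to dissolve (MMSW Questions 9.11/9.12: even `X # rℂℙ² ≅ rℂℙ²`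
  open for `D(𝒫)` presentation spheres); lasagna blindness is over `ℚ` and for `ℂℙ²bar`; positive results remove sub-families
  (ribbon / twist-spun / 0-concordant-to-unknot 2-knots; twist-roll spins of unknotting-number-one knots).
* **Caveats.** Only ONE-step dissolution printed (`r = 1`); class for unoriented connected manifolds; Cor 1.13 vendored for knots only;
  KM 2013 Cor 1.1 ("`s = 0` in any homotopy ball") was WITHDRAWN (`s ≠ s♯`).
* **Threatens.** `ZeroSurgeryExotic` (B27 `crux_witness_avoids_gluckTwist`, `not_crux_of_cp2Rigid`; B28), `DottedCircleRasmussen`,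
  `TwistorDissolution` (crux `CP2Cancellation` is the POSITIVE use: prove dissolution for all homotopy spheres), `PIC` (`PicGluckV2`).

### A8 · `CappellShanesonFamilyBarrier`, `CappellShanesonSmallEntryBarrier` — the worked-out Cappell–Shaneson spheres are standard
* File `CappellShanesonFamilyStandard.lean` (+ `…ColumnMove`, `…Holds`, `…Leaves`, `…NegSixEleven`, `…Proofs`: towards discharging Gompf Thm 3.2).
* **Statement.** Class `ExoticCappellShanesonSphere 𝒜 := ∃ A ∈ 𝒜, ∃ X` closed smooth, `IsCappellShanesonSphereOf A X ∧ IsEmpty (X ≃ₘ 𝕊 4)`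
  (monotone in `𝒜`; `exoticCappellShanesonSphere_univ_iff`: with ALL matrices it is exactly `¬ CappellShanesonSpheresStandard`, OPEN).
  Barriers: `CappellShanesonFamilyBarrier := ¬ ExoticCappellShanesonSphere (range cappellShanesonMatrix)` (the family `Aₘ`, both
  framings) and `CappellShanesonSmallEntryBarrier := ¬ ExoticCappellShanesonSphere gompfSmallEntryClass` (Gompf standard form,
  `det(A−1) = 1`, `|d| < 17`); Cor 3.5 contrapositive: an exotic CS sphere needs `|d| ≥ 17, |a+ce| ≥ 9, |c−1/2| > 4, |c+f−3/2| > 8`.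
* **Status.** `cappellShanesonFamilyBarrier_of_akbulut_gompf (hAG : ∀ X, nonempty_diffeomorph_sphere_four_of_isCappellShanesonSphereOf X)`,
  `cappellShanesonSmallEntryBarrier_of_gompf (hG : gompf2010_theorem32_d)` — named facts (Akbulut 2010 Thm 1; Gompf 2010 Thm 3.2),
  discharge in progress (`…Holds.lean`, `…NegSixEleven.lean`: `aitchisonRubinstein1984_uniqueTraceClass_negSix_eleven` discharged).
* **Kills.** `¬SPC4` via the Akbulut–Kirby sphere / the `Σₘ` (the FGMW `s`-attack targets); any CS candidate in Gompf's classes.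
* **Escape.** CS matrices outside Thms 3.2/3.4 (Gompf: "does not presently know whether they cover all"); other constructions.
* **Caveats.** Standard form not unique; trace-congruence parts of Thms 3.2/3.4 not rendered.
* **Threatens.** `CsArithmeticWalk` (closed, C4: its target was `CappellShanesonSpheresStandard`, not the Statement),
  `CyclicSymmetryRung`, `AlgebraicDegree`, any `negation`-lens seat proposing CS candidates.

### A9 · `CircleActionBarrierFour` — homotopy 4-spheres with an effective smooth circle action are standard (Fintushel, Pao; Perelman)
* File `CircleActionsStandard.lean` (+ `…OrbitTypes`, `…IsotropyProofs`, `…Proofs`: step (1) of the printed proof formalised).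
* **Statement.** `ExoticSphereWithCircleActionFour := ∃ M` closed smooth with `MulAction Circle M`, `FaithfulSMul`, `ContMDiffSMul (𝓡 1) (𝓡 4) ∞`,
  `Nonempty (M ≃ₕ 𝕊 4) ∧ IsEmpty (M ≃ₘ 𝕊 4)`; barrier `CircleActionBarrierFour (hFP) : ¬ ExoticSphereWithCircleActionFour`;
  `ExoticSphereWithCircleActionFour.not_smoothPoincare`.
* **Status.** rel. `fintushelPao_circleAction_homotopySphere_four` (Fintushel 1978 Thm 13.2, Pao 1978 Thms 3–4 in the smooth reading
  of Edmonds Problem 27 / Plotnick 1984, + Perelman; not discharged).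
* **Kills.** Any `S¹`- (hence torus-, compact-connected-Lie-group-) symmetric construction of an exotic `S⁴`; equivalently exotica from
  legally weighted simply connected 3-dimensional orbit spaces.
* **Escape.** FINITE group actions (exotic free involutions exist: A15; no standardness theorem for homotopy spheres with finite
  symmetry is printed) — the bet of `CyclicSymmetryRung` (OddCyclicRung), `QuotientSpheres`, `RealQuotientSpheres`, `ExoticMirrors`.
* **Caveats.** Printed theorems are locally-smooth / up to equivariant homeomorphism; the smooth "≅ S⁴" reading is from secondary
  sources; Fintushel 1976 unread (paywalled).
* **Threatens.** `CyclicSymmetryRung` (its SymInfty step "large cyclic symmetry ⇒ circle action" lands INSIDE the barrier by design —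
  the barrier is its engine), `QuaternionicSimilarity` (free `SU(2)`/`S¹` actions on `S⁷` descend?), `ExoticMirrors`.

### A10 · `LowGenusTrisectionBarrier`, `LargeKTrisectionBarrier` — trisections of genus `≤ 2`, or with some `kᵢ ≥ g − 1`, carry no exotic 4-sphere
* File `LowGenusTrisectionsStandard.lean` (+ `…Proofs.lean`).
* **Statement.** `ExoticTrisectedSphereOfGenusLE g₀ := ∃ X` closed connected oriented smooth with an `IsGKTrisection X g k S`, `g ≤ g₀`,
  `X ≃ₕ 𝕊 4`, `IsEmpty (X ≃ₘ 𝕊 4)` (monotone; `exoticTrisectedSphereOfGenusLE_of_exotic`: every exotic `S⁴` lies in some class, given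
  Gay–Kirby existence, DISCHARGED `exists_isBalancedGKTrisection_holds`). Barriers `LowGenusTrisectionBarrier := ¬ ExoticTrisectedSphereOfGenusLE 2`,
  `LargeKTrisectionBarrier := ¬ ∃ … IsGKTrisection X g k S ∧ (∃ i, g ≤ k i + 1) ∧ …exotic`. Consequences `three_le_genus_of_exotic`,
  `exotic_trisection_constraints`, `eq_one_of_exotic_of_genus_three`: an exotic `S⁴`'s trisection has `g ≥ 3`, all `kᵢ ≤ g − 2`, and at
  genus 3 is of type `(3;1,1,1)`.
* **Status.** `lowGenusTrisectionBarrier_of_msz (hχ : gkTrisection_genus_eq_sum_of_homotopyEquiv_sphere) (hMSZ : msz_homotopySphere_gk)`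
  — `hχ` (Euler characteristic `g = Σkᵢ` for homotopy spheres) DISCHARGED (`TrisectionEulerProofs.lean`), MSZ Thm 1.2 named fact;
  alternative `…_of_mz` from Meier–Zupan.
* **Kills.** Small trisection-diagram counterexamples; for positive routes it marks the solved range: FIRST undecided type `(3;1,1,1)`.
* **Escape.** Genus `≥ 3` with all `kᵢ ≤ g−2`; MSZ Conjecture 3.11 (all trisections of `S⁴` standard) "likely false" even for `S⁴`.
* **Caveats.** Stated over the corrected `IsGKTrisection` (sectors with corners); the older `IsTrisection` of `SmallTrisections.lean` is
  VACUOUS (C7).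
* **Threatens.** `GroupTrisection` / `CongruenceShadows` (their whole content starts at `(3;1,1,1)`: B6–B12),
  `CircularKirby`, `NoOneHandles`.

### A11 · `SmallExoticaBarrier` — the `b₂`-graded strengthening fails from `b₂ = 3` on (Akhmedov–Park) — NARROWED 2026-08-17 to TYPE-BLIND `b₂`-graded arguments
* File `SmallExoticaFrontier.lean` (+ `…OddForms`, `…Reduction*`, `…Proofs`: Lemma 8 formalised up to two non-classical inputs; audit companion
  `SmallExoticaFrontierNarrow.lean`).
* **Statement.** `SimplyConnectedRigidityUpTo k := ∀ M N` closed smooth simply connected, `HasSecondHomologyRankLE k M → Nonempty (M ≃ₜ N) → Nonempty (M ≃ₘ N)`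
  (antitone in `k`; `k = 0` ⇒ SPC4 given Freedman + the `π₁/H₂` characterisation). Barrier `SmallExoticaBarrier := ¬ SimplyConnectedRigidityUpTo 3`;
  `not_simplyConnectedRigidityUpTo_of_three_le`: fails for every `k ≥ 3`.
* **Narrowing (`SmallExoticaFrontierNarrow.lean`).** `SimplyConnectedRigidityUpToOn P k` (the same rigidity restricted to a family `P` of
  intersection-form TYPES), `SimplyConnectedRigidityUpToOn.nonempty_diffeomorph_sphere` (`k = 0` ⇒ SPC4 for every `P` containing the zero form),
  `not_simplyConnectedRigidityUpToOn_of_akhmedovPark` / `_of_lemma8`: the Akhmedov–Park witness kills exactly the families containing the ODD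
  INDEFINITE `σ = −1` rank-3 form (`P =` odd / indefinite / `σ = −1`). NOT reached by any witness in tree or in print at small rank: `HasEvenForms`,
  `HasSignatureZero`, `HasDefiniteForms` — first known failures: even / `σ = 0` at `b₂ = 22` (`#₁₁(S²×S²)`, Baykur–Hamada 2023 Thm A; homotopy K3's)
  resp. `b₂ = 18` (`#₉(ℂℙ² # ℂℙ²bar)`); DEFINITE simply connected exotica: none known at any rank (Stipsicz–Szabó 2024 §1; exotic definite
  manifolds exist only with `π₁ = ℤ/2`).
* **Status.** rel. `akhmedovPark2010_exotic_bTwo_three` (AP 2010 Thm 1(i), `m = 2`: infinitely many smooth structures on `ℂℙ² # 2ℂℙ²bar`,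
  rendered as `H₂ ≅ ℤ³`; not discharged; `…ReductionProofs`: classical leaves (Wall odd case, Freedman) discharged, SW leaf named).
* **Kills.** Proving SPC4 as the `b₂ = 0` case of a homeo⇒diffeo theorem insensitive to `b₂ ≤ 2` AND to the TYPE of the form; a `b₂`-graded
  lemma stated for even forms, for signature zero, or for definite forms is NOT killed below rank 22 / 18 / ∞ respectively (`S⁴` has the zero
  form: even, definite and `σ = 0` at once).
* **Escape.** Techniques specific to `b₂ ≤ 2` (`S⁴, ℂℙ², S²×S², ℂℙ²#ℂℙ²bar, ℂℙ²#ℂℙ²`: all open), or graded through an even / spin / definite /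
  `σ = 0` family; at `b₂ = 0` the SW invariants that make `b₂ = 3` exotic are unavailable (A2) — the frontier is a statement about the
  literature (2010/2023), not a theorem.
* **Threatens.** Rigidity-flavoured routes whose key lemma sees neither `b₂` nor parity: `RicciFat`, `EntropyRung`/`EntropyLadder` (entropy
  thresholds must separate `S⁴` from `ℂℙ² # 2ℂℙ²bar`-type exotica only if they claim more than `b₂ = 0`), `IsotropicCorkBracketing`.

### A12 · `RelativeContractibleBarrierFour`, `ContractibleBarrierFour` — the analogue for compact contractible 4-manifolds fails, relatively (corks) and absolutely
* File `ExoticContractible.lean` (+ 20 `ExoticContractible*Proofs` files: Akbulut–Ruberman Thm A/B architecture, cork theorem route, Kang route, universes).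
* **Statements.** (a) `RelativeContractibleRigidityFour` (DEPRECATED as a fact — REFUTED): every boundary diffeomorphism of a compact
  contractible smooth 4-manifold that extends to a homeomorphism extends to a diffeomorphism; `not_relativeContractibleRigidityFour (hA : akbulut1991_mazurCork)`;
  barrier `RelativeContractibleBarrierFour := ¬ RelativeContractibleRigidityFour`. (b) `ContractibleRigidityFour` (DEPRECATED — NOT A
  FACT, mis-cited): homeomorphic compact contractible smooth 4-manifolds with diffeomorphic boundaries are diffeomorphic;
  `not_contractibleRigidityFour (hAR : akbulutRuberman2016_theoremB)`; barrier `ContractibleBarrierFour := ¬ ContractibleRigidityFour`.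
* **Status.** rel. `akbulut1991_mazurCork` (Mazur cork: `f` extends to homeo not diffeo; implied by any `IsCork`, `akbulut1991_mazurCork_of_isCork`)
  and `akbulutRuberman2016_theoremB`; neither discharged (XL: needs a gauge-theoretic leaf); `ExoticContractibleCorkHomeomorphProofs`:
  Thm B WITHOUT Freedman from a cork + Thm A leaves; `ExoticContractibleKangProofs`: Thm B from Kang's pair.
* **Kills.** The natural strengthenings of SPC4 / of Cerf's extension theorem from `(B⁴, S³)` to all compact contractible 4-manifolds;
  any crux asserting boundary-diffeo extension or homeo⇒diffeo for contractible pieces WITHOUT using `∂ = S³`.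
* **Escape.** Boundary `S³` (homotopy 4-balls): (a) holds there (`Γ₄ = 0`) and (b) IS the open problem, same strength as SPC4; corks
  ORGANISE closed exotica (cork theorem) rather than obstruct SPC4.
* **Caveats.** Vendored without involutivity / without naming the Mazur manifold; Stein refinements not rendered.
* **Threatens.** `ConvexBisection` (crux `ContractibleTwistedDoubleStandard` restricts to contact doubles of CONTRACTIBLE Stein
  domains glued along the common seam — outside (b) because both halves and the gluing are constrained; B3), `TransparentBalls`,
  `ThreePointSpheres` (protocork ladder), `IsotropicCorkBracketing`, `RicciFat` (cork symmetrisation), `Stabilisation`.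

### A13 · `OneStabilisationBarrier` — one stabilisation is not enough for contractible 4-manifolds (Kang 2022)
* File `OneStabilisationContractible.lean` (+ `…ARProofs`, `…CorkProofs`, `…Proofs`, `…SufficesProofs`).
* **Statement.** `OneStabilisationSufficesContractible`: homeomorphic compact contractible smooth `W₁, W₂` with diffeomorphic boundaries
  have diffeomorphic one-fold stabilisations `Wᵢ # S²×S²` (relational `IsConnectedSum … ((𝕊 2) × (𝕊 2))`); barrier `¬` that;
  `oneStabilisationBarrier_of_kang (hK : kang2022_corollary12)`.
* **Status.** rel. Kang Cor 1.2 (arXiv:2210.07510 v3 — gaps fixed after refereeing; "announced" per Powell 2026; not discharged).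
  `…SufficesProofs`: the master statement is exactly `¬` Cor 1.2; `…CorkProofs`: the relative, cork-level form `kang2022_theorem11` over the
  notion `ExtendsOverStabilisation` (a cork twist not extending over ONE stabilisation).
* **Kills.** Uniform "one `S²×S²` summand dissolves the cork" lemmas; the natural strengthening of `Stabilisation`'s conjunct S1
  from homotopy spheres to all contractible pieces.
* **Escape.** The CLOSED simply connected case is open (no closed pair needing two stabilisations is known; Kang Question 1); S1 for
  homotopy spheres itself is untouched. Recorded evasions (audit 2026-08-16): TWISTED stabilisation `# S²×~S²` / `# ℂℙ² # ℂℙ²bar` and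
  characteristic spheres (Hayden–Kang–Mukherjee 2023 Lemma 3.1, Prop 3.3); corks for which one stabilisation IS enough (positron-type);
  and the barrier's reach over INVOLUTIVE corks of homotopy spheres is only non-constructive (Kirby's cork theorem 1996 + Matveyev + `Θ₄ = 0`,
  `OneStabilisationContractibleProofs` §"Reach over involutive corks").
* **Threatens.** `Stabilisation` (S1, `PinchedStabilisation` of `OneHandleSplitting`), `CommonDualRelay` (`OneSummandCommonDuals`), `ThreeFibres`,
  `OneStabInvertible` (one stabilisation of an invertible homotopy sphere), `DissolvableGluck`, `YamabeExtremalSpheres`' `RoundCorkRefill` stub (B43).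

### A14 · `OpenAnalogueBarrierFour` — the open analogue fails inside `S⁴` itself: small exotic `ℝ⁴`'s — NARROWED 2026-08-17 to END-BLIND arguments
* File `ExoticOpenFourSpace.lean` (+ `…Transport` (inside EVERY smooth 4-manifold), `…Leaf`, `…KirbyProofs`, 16 `deMichelisFreedman1992_continuum`
  proof files; audit companion `ExoticOpenFourSpaceNarrow.lean`).
* **Statement.** `OpenSubsetUniquenessFour := ∀ U : Opens (𝔼 4), Nonempty (U ≃ₜ 𝔼 4) → Nonempty (U ≃ₘ 𝔼 4)`; barrier `¬` that;
  `openAnalogueBarrierFour_iff_exoticR4`: EQUIVALENT to the tree fact spc4.S11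
  `exists_opens_nonempty_homeomorph_isEmpty_diffeomorph_euclideanSpace_four` (Mathlib `proof_wanted`; Kirby 1989 XIV Thm 3).
  `exists_opens_sphere_homeomorph_not_diffeomorph`: the standard `S⁴` contains an open `ℝ⁴`-homeomorph not diffeomorphic to `ℝ⁴`;
  `…Transport`: so does EVERY nonempty smooth 4-manifold (`not_forall_opens_diffeomorph_of_exoticR4`); `deMichelisFreedman1992_continuum`:
  continuum many, pairwise non-diffeomorphic.
* **Narrowing (`ExoticOpenFourSpaceNarrow.lean`).** `IsSmoothSphereInterior U` (U is the interior of a smooth compact 4-ball-with-`S³`-boundary /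
  `≅ ℝ⁴` with standard end); named fact `huebschMorse1962_sphereInterior` (Huebsch–Morse 1962 Thm 3.1, Stallings 1965 Thm 2: an open subset of `S⁴`
  homeomorphic to `ℝ⁴` whose END is standard (collared by `S³ × ℝ`) IS diffeomorphic to `ℝ⁴`); `not_isSmoothSphereInterior_of_isEmpty_diffeomorph`
  (so every exotic open `ℝ⁴` in `S⁴` has a NON-standard end), `openAnalogueBarrierFour_narrow`: the barrier kills only END-BLIND arguments —
  those that use `U ≃ₜ ℝ⁴` + `U ⊆ S⁴` and nothing about the end of `U`.
* **Correction to the 2026-08-16 entry.** "Kills: `Σ ∖ {p}` smoothly embeds in `ℝ⁴` ⇒ standard" was WRONG: for a homotopy sphere `Σ`,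
  (A) `Σ ∖ {p}` embeds in `ℝ⁴` ⇔ `Σ` is invertible (`Σ # Σ' ≅ S⁴` for some `Σ'`) ⇒ `Σ ∖ {p} ≅ ℝ⁴` IS A THEOREM (Huebsch–Morse / Stallings: the end of
  `Σ ∖ {p}` is standard); what stays open is the smooth SCHOENFLIES half `Σ ∖ {p} ≅ ℝ⁴ ⇒ Σ ≅ S⁴`
  (`Literature.Topology.FourManifolds.SmoothSchoenfliesConjectureFour`). SPC4 ⇔ (A: every homotopy 4-sphere is invertible) ∧ (smooth 4-d
  Schoenflies) (FGMW 2010 §1 footnote) — both conjuncts open; B40 `exists_nonInvertible_of_not_dcrRigidity` lives on conjunct (A).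
* **Status.** rel. spc4.S11 (not discharged — an unconditional proof IS a formal small exotic `ℝ⁴`, XL); `OpenSubsetUniquenessFour`
  triaged NOT A FACT (C8); `huebschMorse1962_sphereInterior` named fact (M-sized classical, not discharged).
* **Kills.** End-blind detectors "`Σ` contains an exotic open `ℝ⁴` ⇒ `Σ ≇ S⁴`" (the standard `S⁴` contains them too) and end-blind recognisers
  "`U ⊆ Σ` open, `U ≃ₜ ℝ⁴` ⇒ `U ≅ ℝ⁴`"; NOT killed: anything reading the end of `Σ ∖ {p}` (which is standard) — those arguments face Schoenflies instead.
* **Escape.** Compactness- or end-sensitive arguments; LARGE exotic `ℝ⁴`'s do not embed in `S⁴`; nothing printed links exotic `ℝ⁴`'s to exotic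
  `S⁴`'s in either direction; the invertibility conjunct (A) has its own tools (`#`-inverses, FGMW's dotted-circle knots B39–B40).
* **Threatens.** `SullivanDual` / `TameOrBrodyR4`-type cruxes (recognising `ℝ⁴` by a tameness condition must use more than topology +
  embedding), `SymplecticCap` (B24), `EuclideanOrigami` / `SchoenfliesSplit` (`PuncturedEmbeds` = conjunct (A), #0371), `ConvexityLadder`,
  `SpectralDevelopingMap`, `SmoothBijectionDefect`, `SteinHost`, `OneStabInvertible` (conjunct (A) explicitly).

### A15 · `ProjectiveRigidityBarrierFour` — the `ℤ/2`-equivariant strengthening fails: exotic free involutions on `S⁴` / fake `ℝℙ⁴`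
* File `ExoticFreeInvolutions.lean` (+ `…Proofs.lean`: `¬ ProjectiveRigidityFour ⟺` an exotic free involution exists).
* **Statement.** `ProjectiveRigidityFour := ∀ X` closed smooth, `IsFreeInvolutionQuotientOfSphere 4 X → IsRealProjectiveSpace 4 X`;
  barrier `ProjectiveRigidityBarrierFour (hE : exists_exoticFreeInvolutionQuotient_four) : ¬ ProjectiveRigidityFour`;
  `exists_homotopyEquiv_not_diffeomorph_realProjective`; `antipodalDiffeomorph` API.
* **Status.** rel. named fact (Fintushel–Stern 1981; Cappell–Shaneson fake `ℝℙ⁴` with universal cover `Σ₀ ≅ S⁴` by Gompf 1991 +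
  Akbulut 2010; not discharged).
* **Kills.** Proofs of smooth rigidity of `S⁴` NATURAL under free `ℤ/2`-actions (descending to / lifting from the quotient): they would
  prove `ProjectiveRigidityFour`, which is false; the `π₁ = ℤ/2` space-form strengthening of SPC4.
* **Escape.** The phenomenon lives in the quotient (detected by `ρ`/`η`/Pin-type invariants vanishing upstairs); orientation-preserving
  finite actions with fixed points are not covered (bet of `QuotientSpheres`, `CyclicSymmetryRung`).
* **Threatens.** `RealQuotientSpheres`, `QuotientSpheres`, `ExoticMirrors` (reflections of `S⁵`), `QuaternionicSimilarity`, any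
  `antipodal`-based card (`antipodal-dissolution-projective-schoenflies`).

### A16 · `StrictPropertyTwoRBarrier` — printed Property 2R would trivialise the Gompf–Scharlemann–Thompson presentations (Andrews–Curtis), CONDITIONAL
* File `PropertyTwoRAndrewsCurtis.lean` (+ `…ACMoves` (robustness of the AC hypothesis), `…Hypothesis`, `…Link`, `…Proofs` (`n ≤ 2`; barrier ⇔ GST §7 implication)).
* **Statement.** `gstPresentation n = ⟨x, y ∣ yxy = xyx, xⁿ⁺¹ = yⁿ⟩` (`= ` swapped Akbulut–Kirby presentation for `n = k+2`);
  OPEN `AKPresentationsACNontrivial := ∃ n ≥ 3, ¬ IsAndrewsCurtisEquivalent (gstPresentation n) (trivial 2)`; barrier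
  `StrictPropertyTwoRBarrier := AKPresentationsACNontrivial → ¬ StrictPropertyTwoRConjecture`, derived from GST's §7 implication
  `hGST : StrictPropertyTwoRConjecture → ∀ n, IsAndrewsCurtisEquivalent (gstPresentation n) (trivial 2)` (`strictPropertyTwoRBarrier_of_gst`,
  and `_iff_gst`); `not_strictGeneralizedPropertyR_of_gst`. DEPRECATED (MISSTATED, stronger than source): `gst2010_propertyTwoR_andrewsCurtis`,
  `PropertyTwoRBarrier` (over the PERMISSIVE `PropertyTwoRConjecture` / `IsHandleSlideEquivalent`, whose "slide" can change the
  surgered manifold — `KirbyMoves.lean` errata) — C6.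
* **Status.** Conditional twice: on the open AC-nontriviality and on the vendored §7 prose implication.
* **Kills.** SPC4 for 1-handle-free homotopy spheres via the STRICT (slides-only) Generalised Property R; any route statement implying
  the printed conjecture; the unlink-stabilised version (stable AC class preserved).
* **Escape.** The WEAK Generalised Property R with cancelling Hopf pairs (destroys the AC invariant; EQUIVALENT to SPC4 for 1-handle-free
  homotopy spheres, GST Prop 9.2) — conjunct C2 of `NoOneHandles` is exactly this and is untouched; `n = 1` (Gabai); permissive slide
  sequences are not reached by the AC invariant at all.
* **Threatens.** `NoOneHandles` (C2 safe, any strict-slide restatement dies), `CircularKirby` (RankOne/RankTwo via slides),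
  `EntropyLadder` (5-dim Andrews–Curtis handlebodies), `RicciTranscript` / `ConvexityLadder` (presentation spheres), `DottedCircleRasmussen`.

### A17 · `az2025_weaklyReducible_genusThree_homotopySphere_gk` — weakly reducible genus-3 trisections of a homotopy 4-sphere are standard (Aranda–Zupan 2025; named fact, SPC4-implied)
* File `WeaklyReducibleGenusThreeStandard.lean` (833 lines; + `…Proofs` (reducible branch), `…OfClassification`, `…OfLoopSurgery`,
  `…OfSeparatingSplitting`; companion `LowGenusTrisectionsStandardOfClassification.lean`). No `BARRIER (D-0021)` block — catalogued here because it
  is the unit's newest negative-side FACT and marks the solved range one notch past A10.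
* **Statement.** `az2025_weaklyReducible_genusThree_homotopySphere_gk := ∀ X` closed connected oriented smooth, `∀ k S, IsGKTrisection X 3 k S →
  Trisection.IsWeaklyReducible S → Nonempty (X ≃ₕ 𝕊 4) → Nonempty (X ≃ₘ 𝕊 4)` (AZ25 arXiv:2503.04607 Thm 1.3 corollary; "weakly reducible" = some pair of
  sectors admits a common reducing curve: `Trisection.isWeaklyReducible_comp_perm`, `_of_zero`, `_of_msz_of_balanced`). Bridges `_iff_topic` /
  `_iff_routeShape` (≡ `Literature.Topology.FourManifolds.arandaZupan_genus_three_weaklyReducible_homotopySphere_gk` ≡ the route-shape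
  `arandaZupan_weaklyReducible_genusThree_homotopySphere`); `_of_smoothPoincare` (SPC4-implied, so never an obstruction to SPC4).
* **Status.** Named fact, NOT discharged (XL: contains Cerf `Γ₄ = 0`). In-tree partial discharges: the REDUCIBLE branch
  `nonempty_diffeomorph_sphere_of_isReducible_genusThree_of_facts / _of_splitting / _of_separating` (from `msz_homotopySphere_gk` A10,
  `msz_trisection_classification_gk`, `Trisection.isConnectedSum_of_reducing_separating`), and `_of_msz_of_separating_of_irreducible` (non-separating
  reducing curves via `msz_loopSurgery_homotopySphere_gk` + a five-chain step; waits on `waldhausen_heegaardSplitting_sumS1S2_unique`).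
* **Kills.** Genus-3 trisection-diagram counterexamples with ANY weakly reducing pair (extends A10's killed range: `g ≤ 2`, `(3;k)` with some `kᵢ = 2`,
  and now weakly reducible `(3;1,1,1)`); for positive routes it grounds `WeakReductionDescent.GenusThreeBase` (#17910, closed modulo the fact by
  `Theorems.genusThreeBase_iff_az2025`) and `DependentTripleGenusThreeStandard` (#18000, B33).
* **Escape.** STRONGLY IRREDUCIBLE `(3;1,1,1)` trisections — whether any exist on a homotopy sphere (or on `S⁴`) is AZ25 Question 8.3; this is
  exactly crux `DependentTripleAtThree` (B32) and the `(c₁,c₃) = (1,1)` sector of `GroupTrisection.GtriMorse1121` (#0435, B3/B32 apex).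
* **Threatens / feeds.** `WeakReductionDescent` (B32–B35), `GroupTrisection`, `CongruenceShadows` (B6–B12), `ConvexBisection` via B3's bet.

### A-supplement · calibration companions worth knowing (no new barrier Prop)
* `StableInvariantsBlindCalibration.lean`: `isStableInvariant_iff`, `stableBarrierFour_iff_eqvGen`, `IsStableInvariant.isHCobordismInvariant`.
* `HCobordismInvariantsBlindProofs.lean` / `HCobordismTheoremFailsProofs.lean` / `TopologicalInvariantsBlindProofs.lean`: "what an
  unconditional proof must contain" — each barrier is EXACTLY as strong as its named leaf (`Θ₄ = 0`, Donaldson's pair, Freedman).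
* `ExoticOpenFourSpaceTransport.lean`: exotic open `ℝ⁴`-homeomorphs inside every smooth 4-manifold (so "contains an exotic `ℝ⁴`" is
  never a detector).
* `GluckTwistsDissolveBeyondGluckProofs.lean`: `dissolvesInCP2_sphere`, `dissolvesInCP2_of_isGluckTwist'` (UNCONDITIONAL),
  `mmsw2023_sZero_of_dissolvesInCP2_iff_nonpos` (the §9.3 fact ⇔ one-sided `s ≤ 0`).
* `PropertyTwoRAndrewsCurtisACMoves.lean`: AC-triviality is insensitive to which move set is allowed (conjugations, permutations, basis changes).
* `SmallExoticaFrontierNarrow.lean`, `ExoticOpenFourSpaceNarrow.lean` (2026-08-17 audit companions): the NARROW classes of A11 / A14 and the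
  families / end-data they do not reach; `TopologicalInvariantsBlindProofs.topologicalBarrierFour_iff` (A1 ≡ smooth FQ 7.1B).

---

## B. Crux-level negative lemmas — `lean/Summits/SmoothPoincare4/SmoothPoincare4/Theorems/<Crux>/Negative/`

Conventions. Every theorem named below is sorry-free and landed through the gate (refuter `cdisprove`/`drefute` seats, standing
disprover work files `Cruxes/<Crux>/Disproof.lean`). Namespace `Summit.SmoothPoincare4.SmoothPoincare4.Theorems.<Crux>.Negative`
(sub-namespaces named where used; a `CapitalisedPrefix.decl` otherwise names the FILE `Negative/<Prefix>.lean` that holds `decl`).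
"SPC4-implied" = the tree proves `SmoothPoincare4 → crux`; "a kill is an exotic `S⁴`" = the tree
proves `¬ crux → ¬ SmoothPoincare4` (§D.1). `_false_without_H` = the crux with hypothesis `H` deleted, everything else verbatim, is
refuted (so every proof must consume `H`). "NEGATIVE-LEMMA HOLD" = a landed `H → ¬ crux` with `H` a `@[conjecture]` / not-yet-constructible
hypothesis: the item is held open (not staffed), `H` filed as a construction item — it is NOT a refutation. Items are `stmt-SmoothPoincare4-NNNN`
(written `#NNNN`). Census 2026-08-17: 202 `Negative/*.lean` files over 46 crux directories (gen-1: 28 entries over ~120 files); B29–B47 are new,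
B3, B4, B7, B17, B22, B23, B26 carry 2026-08-17 additions.

### Route `ConvexBisection` (Stein bisections of homotopy 4-spheres along a common contact seam)

#### B1 · `AcyclicBisectionExists` (#10508, rank-2 crux; 10 files) — every `M ≃ₕ S⁴` has a Stein bisection along a common contact seam with ℚ-acyclic halves
* **Load-bearing.** `acyclicBisectionExists_false_without_homotopyEquiv` (Witness.lean; drop `M ≃ₕ S⁴` ⇒ false, via compactness);
  `not_acyclicBisectionExistsAllDegrees` (the degree guard `0 < k` in "ℚ-acyclic": false at the round `S⁴` without it).
* **Refuted weakenings.** `not_hasAcyclicSteinBisection_complexProjectivePlane`, `not_acyclicBisectionExistsForSimplyConnectedClosed`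
  (Closed.lean: `M ≃ₕ S⁴` cannot be weakened to "closed simply connected" — `ℂℙ²`); `not_acyclic_of_finrank_homology_four_ne_one`
  (TopDegree.lean: `b₄ ≠ 1` — non-orientable or non-compact `M` — carries no acyclic witness); `isZero_homology_of_acyclic` /
  `rationalHomologySphere_of_acyclic`: ANY `M` with an acyclic witness is a ℚHS⁴ — the homotopy hypothesis is consumed exactly through
  `b₁ = b₂ = b₃ = 0`, `b₄ = 1`.
* **What holds for free.** `hasAcyclicSteinBisection_sphere` (tight at `S⁴`), `hasAcyclicSteinBisection_of_isDouble` (Doubles.lean: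
  the ∃-body HOLDS on every double `D(W)` of a ℚ-acyclic compact Stein `W` — the `ψ = id` sector is free and `HasAcyclicSteinBisection M ⇏ M ≃ₕ S⁴`,
  paper `D(B_{p,q})`), `hasAcyclicSteinBisection_of_twistedGlue` (TwistedDoubles.lean: every CONTACT twisted double `W₁ ∪_ψ W₂`
  satisfies the ∃-body), `acyclic_iff_seam_of_homotopyEquiv` / `acyclic_iff_connected_and_seam` (acyclic ⇔ connected halves + seam a
  ℚHS³), `acyclicRight_of_acyclicLeft_of_homotopyEquiv'` (OneSided.lean: control on ONE half suffices).
* **Position.** `acyclicBisectionExists_of_spc4`, `not_spc4_of_not_acyclicBisectionExists`, `exotic_of_not_acyclicBisectionExists`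
  (Sphere.lean): SPC4-implied; a kill IS an exotic `S⁴`.
* **Line-level (line `modp-braid-orbits`).** `ExchangeNonzero.not_stub_exchange_without_nonzero` (non-vanishing of the letters in
  `stub_exchange` is load-bearing: genus-1 word `(0,+)(e,+)(e,−)(f,−)`); `ModpOrbit.stub_modpOrbit_false_without_omegaConnected`
  (`OmegaConnected` load-bearing in `stub_modpOrbit` at `g = 2` for EVERY prime `p ≡ 1 (4)`: decomposable `V₁ ⊥ V₂` witness — no
  threshold `p₀` rescues it).
* **Escape.** Keep `M ≃ₕ S⁴` (or at least ℚHS⁴ + connected); state acyclicity in positive degrees; dictionary stubs must output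
  non-zero, ω-connected letter sets.

#### B2 · `AcyclicBisectionRigidity` (#10507; 8 files) — a homotopy 4-sphere with an acyclic common-contact Stein bisection is `≅ S⁴`
* **Position / shielding.** `shielded_of_spc4` (LoadBearing.lean): EVERY statement `∀ M ≃ₕ S⁴, P M → M ≅ S⁴` is SPC4-implied, so the
  crux and each single-conjunct deletion are unrefutable short of an exotic `S⁴` (`not_smoothPoincare4_of_not_crux`);
  `crux_iff_characterisation` (Transport.lean: the converse is a theorem — every `M ≅ S⁴` carries the bisection).
* **Load-bearing.** `not_crux_without_homotopyEquiv` (empty-manifold witness; paper `S⁴ ⊔ S⁴`, `D(B_{p,q})`);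
  `smoothPoincare4_of_withoutAcyclic` (dropping acyclicity collapses the crux onto SPC4 modulo support `SteinBisectionExists` #10509);
  `crux_iff_compact_pathConnected` (WLOG compact, path connected).
* **Structure theorems (what a proof must split into).** `crux_iff_threeSectors` (SeamCompatible.lean: double sector / contact cork
  twists / non-twin sector); `DoubleSector.doubleSector_of_crux` (identity-glued sector = presentation-sphere sector of B3);
  `crux_iff_twinSector_and_nonTwinSector`, `twinSector_iff_twistedDoubleStubs`, `nonTwinSector_of_twinsLever` (TwinDecomposition.lean:
  the lever `stub_minimalFactorisationTwins` says exactly "the non-twin sector is empty"; the residual twisted-double stubs are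
  consequences of the crux, hence also unrefutable short of an exotic `S⁴` — Targets.lean).
* **Dead levers.** `isDouble_closedBall_of_spc4`, `crux_iff_doubleReduction_of_crux4` (RoundTwoLevers.lean: the round-2 Transfer
  `DoubleReduction` is SPC4-implied and, modulo B3, IS the crux — a costume); `HurwitzTypeCount.typeCount_eq_zero_of_monotoneReducible`,
  `not_monotoneReducible_of_typeCount_ne_zero`, `not_monotoneReducible_pair` (the signed type-count invariant of achiral Hurwitz moves
  kills the `achiral-relator-reduction` lever `T` at `k = 5`: a word with non-zero type count for some conjugation-invariant class is
  never monotone-reducible).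
* **Escape.** A transfer must expose structure the crux lacks (not restate it modulo B3); combinatorial reduction levers must respect
  the type-count invariant.

#### B3 · `ContractibleTwistedDoubleStandard` (#3546; 8 files; lines `property-r-mazur-halves`, `legendrian-r-knot-rigidity`, `legendrian-belt-unlinking` dead) — a closed `X` Stein-bisected along a common contact seam into two compact CONTRACTIBLE Stein domains is `≅ S⁴`
* **Load-bearing.** `not_crux_without_contractible` (empty bisection; honest `D(S¹×D³) = S¹×S³`), `not_crux_without_cover`
  (`S⁴ ⊔ S⁴`), `seam_nonempty`; redundant: `crux_iff_without_compactSpace`, `crux_iff_minimal` (`CompactSpace X`, `SecondCountableTopology X`).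
* **Dictionary (both directions certified).** `steinBisection_of_contactGluing` (ContactGluing.lean: EVERY gluing `W₁ ∪_ψ W₂` of compact
  Stein domains along a contactomorphism satisfies the six hypotheses), `steinBisection_of_isDouble`, `crux_hypotheses_at_sphere`
  (DoubleBisection.lean: non-vacuity at `S⁴`), `mem_contactPlane_iff_of_matching` (SeamContacto.lean: the matching clause makes the
  seam map a contactomorphism).
* **Position.** `Spc4Sector.oneOneTwoOneOne_of_spc4`: SPC4 ⇒ the BET `stub_homotopySphereOneOneTwoOneOne` of line
  `property-r-mazur-halves` (p108569); with the landed `stub_closedOneZeroOne` (p108247) the bet is EXACTLY SPC4 for handle profile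
  `(1,1,2,1,1)`; `nonSmallSector_of_crux` (the residual stub is the crux restricted to non-simply-connected seams).
  `SphereAcyclicBisection.acyclicBisection_sphere`: `S⁴` lies in every sub-sector — no ConvexBisection crux is refutable from the round sphere.
  2026-08-17: `GtriMorse1121Sector.oneOneTwoOneOne_of_gtriMorse1121` + `gtriMorse1121_iff` (`Iff.rfl` with the skeleton's stub) — the bet IS the
  `(c₁,c₃) = (1,1)` sector of the existing crux `GroupTrisection.GtriMorse1121` (#0435), so the line's apex is an ITEM, not a lemma;
  `Spc4ImpliesCrux.crux_of_spc4 : SmoothPoincare4 → ContractibleTwistedDoubleStandard` (via the landed `PropertyRMazurHalves.stub_homotopySphere`,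
  p112822), `not_spc4_of_not_crux`, `nonSmallSector_of_spc4`: the crux is SPC4-implied (§D.1) — unrefutable short of an exotic `S⁴`.
* **Escape.** The crux sits inside A12's forbidden zone only if stated for arbitrary gluings; the common-seam CONTACT condition +
  contractibility of BOTH halves is what keeps it outside `ContractibleBarrierFour`.

#### B4 · `PlanarAcyclicBisectionRigidity` (#15086; 2 files + `Cruxes/…/PlanarLefschetzBodyCounterexample.lean`) — the `k = 4` planar shadow walk; the v3 dictionary stub
* `ShadowBallUnreachable.not_forall_reachable_isBallState`: the BALL-only form of the lever `stub_shadowWalkK4` (every start state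
  `[a₁, a₂, b₂⁻¹, b₁⁻¹]` of the `F₂` shadow reaches a ball state by signed Hurwitz moves) is FALSE — the `s`-twin word of length 18 has
  all letters fixing a point under `x ↦ (1 2), y ↦ (0 2)` in `S₃`, and `not_isBallState_of_reachable_of_forall_fix`; the honest
  DOUBLE target is met on the same instance. Escape: levers must allow double states (twisted doubles), not only balls.
* `Sketch.helper_dictionaryFacts_false`, `helper_dictionaryFacts_refuted_conjuncts` (ns `…PlanarAcyclicBisectionRigidity.Sketch`): the itemised
  dictionary stub `stub_dictionaryFacts` of skeleton v3.0–3.1 is FALSE AS RENDERED — the `IsPageSystem` clause of `IsLefschetzHandlebodyOver` pins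
  the boundary open book only up to boundary multitwists, so `𝔻⁴` is a "planar Lefschetz body over `P₁` with no letters" and `S⁴` a "planar word
  manifold of the empty word" (`not_planarLefschetzBody_length_of_acyclic`); line reshaped v4.0. Lesson (§D.3): an open-book / page-system
  predicate must fix the monodromy, not only the page.

#### B5 · `PlanarBisectionRigidity` (#10511; 1 landed file + `Cruxes/PlanarBisectionRigidity/Disproof.lean` v7.2, sorry-free, landing pending)
* **Landed.** `Negative/SeamExtension.lean`: a seam extension `F : W₁ ≅ W₂` ALREADY gives `IsDouble` — the conclusion of lever
  `stub_contractibleHalfDouble` (line `coloured-string-links-square-free-ac`) — with no 5-manifold, Stein structure, planarity or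
  homotopy hypothesis; since the line's engine (C2) only succeeds by producing such an `F`, its non-trivial reach is EMPTY.
* **Checked in the work file (cite as `Cruxes/PlanarBisectionRigidity/Disproof.lean`, §n).** `of_smoothPoincare4`, `not_iff_exotic`
  (§1: SPC4-implied; a kill is an exotic `S⁴` with a planar seam); `withoutPlanar_iff_smoothPoincare4` (§3: modulo `SteinBisectionExists`,
  dropping PLANARITY gives back SPC4 — planarity is THE load-bearing restriction); `withoutHomotopyEquiv_false_of` (paper `S¹×S³ = D(S¹×D³)`
  with planar seam; formal modulo a planar Stein domain with `b₁ > 0`); `planarContactBoundary_steinBall`, `hasPlanarSteinBisection_sphere`,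
  `planarBisectionExists_of_smoothPoincare4` (§5: non-vacuity at `S⁴`, support #10512 is SPC4-implied); §6 REFUTED ON PAPER:
  `SeamIsSphere` / `HalvesAreBalls` (planar bisection ⇒ seam `S³`) — false: `S⁴ = D(C)` for the Akbulut–Mazur cork with its PLANAR Stein
  structure (Karakurt–Oba–Ukida Prop 2.3), seam a Brieskorn-type ℤHS³; §7: with 4 binding components every planar-bisected homotopy
  sphere is a reflection-twin cork twist of `S⁴` along a planar Mazur-type cork (Oba 2016 Thm 1.1).

### Routes `CongruenceShadows` / `GroupTrisection` (group trisections of the trivial group; `S = S_{3+3m}`, `N = s4Kernels.stabilizeIter m`)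

#### B6 · `AgkCor6Sufficiency` (#10894, shared crux; 11 files) — `X → SmoothPoincare4`, `X` = AGK Cor 6 condition "every `(3k,k)` group trisection of `{1}` is stably trivial"
* **Tightness of AGK's family.** `isStablyTrivial_tight` (stably trivial `(g,k)` trisection of `G` ⇒ `g = 3k ∧ G ≅ 1`);
  `UnbalancedFalse.not_forall_isGroupTrisection_punit_isStablyTrivial` (balance load-bearing: `(1,0)` trisection of `ℂℙ²`);
  `AnyGroupFalse.not_forall_isGroupTrisection_isStablyTrivial` (`G = 1` load-bearing: `zKernels`, the `(3,1)` trisection of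
  `S¹×S³ # ℂℙ² # ℂℙ²`, `χ = 2`, `π₁ = ℤ`); `StabilizeRetract.not_forall_isGroupTrisection_punit_stabilizeIter_eq` (the re-marking
  automorphism inside `IsStablyTrivial` is load-bearing: "LITERALLY standard after stabilising" is false; `stabilize_injective` —
  stabilisation remembers the triple).
* **No finite truncation.** `DownwardClosed.agkCondition_downward`, `agkCondition_of_frequently` (`X_k` downward closed: provers may
  assume `k ≥ k₀`; no refutation from small `k`); `WitnessNormalForm.agkCor6SufficiencyUpTo_zero_iff_smoothPoincare4` (the truncation
  `X_{≤0} → SPC4` IS the summit), `isStablyTrivial_iff_exists`, `eq_of_isStablyTrivial_witness` (`k + n = m + 1`).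
* **Position.** `LoadBearingRigidity.not_agkCor6Sufficiency_iff_exotic` (`¬crux ⇔ X ∧` exotic `S⁴`),
  `not_agkCor6Sufficiency_imp_not_leaves` (`¬crux` refutes the conjunction of the two open leaves (b′) `diffeomorph_of_iso_groupGKTrisectionOf`
  ∧ (c′) `exists_stabilized_gkTrisection`; Gay–Kirby Thm 4 is discharged), `rigidityVsSphere_of_smoothPoincare4` (the load-bearing
  INSTANCE of (b′) is SPC4-implied). The crux is a published theorem: risk = vendoring fidelity (cf. C7).
* **Line-level.** `KernelNecessity.extends_iff_kernel` (handlebody-extension stubs are `iff`s: the kernel condition is NECESSARY);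
  `FillingUniquenessIffLP.fillingUniqueness_iff_laudenbachPoenaru` (the lever of line `lp-by-sphere-system-surgery` IS Laudenbach–Poénaru:
  a new proof, not an easier statement); `LevelStabilizeOneRemarking` + `StabilizeOneLift` (the "for every marking" form of
  `stub_levelStabilizeOne` = one-marking form + re-marking invariance = the tree's Nielsen-lifting gap `hN` RELOCATED, not circumvented;
  invariance proved for liftable `α`: `iso_stabilizeOne_map_of_lift`, `…_of_nielsen`).

#### B7 · `NormalFormStablyTrivial` (#14591, target of `CongruenceShadows`; 4 files) — `∀ m K, IsGroupTrisection (3+3m) (m+1) 1 K → PairsStandard m K → K.IsStablyTrivial`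
* **Load-bearing.** `TripleLoadBearing.normalFormStablyTrivial_false_without_triple` (the any-group version is FALSE: `zKernels` is
  in Waldhausen normal form — `ZKernelsNormalForm.pairs_zKernels` — with `π₁ = ℤ`), `…_false_without_hyp`; `normalFormStablyTrivial_iff_tripleForm`
  (of the trisection hypothesis ONLY `π₁ = 1` is used; `normal`, `free_quotient`, `free_pairQuotient` are decoration);
  `GateNeedsBothSides.tripleForm_false_without_pair12/02/01` (each pair condition load-bearing), `gate_false_without_gamma`,
  `gate_false_without_beta` (each ONE-sided gate condition insufficient: the unbalanced genus-3 trisections of `ℂℙ²`, `K₂ = T_{b₂}N₂` /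
  `T_{b₁}N₂`); `PairRankObstruction.not_isStablyTrivial_of_pairRank` (pair ranks are stable invariants; the pair conditions carry exactly
  balancedness).
* **Reformulation.** `normalFormStablyTrivial_iff_gate_of_nielsen`: modulo Nielsen the crux IS its gate form `(N₀, N₁, K₂)` with
  `K₂ ∈ Stab(N₀)·N₂ ∩ Stab(N₁)·N₂`. Position of line `Sketch` (dead; `Theorems/CongruenceShadowsNormalFormStablyTrivialSketchPosition.lean`):
  `agkCondition_iff_normalFormStablyTrivial` (the crux ⇔ the AGK condition), `stubs_iff_normalFormStablyTrivial` (given `WaldhausenPairs` B8, the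
  two stubs K1 `StablyThreeHandleFree` ∧ K2 `ThreeHandleFreeStablyTrivial` ⇔ the crux: a zero-slack split, blocked on `ShadowApproximation` #14595),
  `stablyThreeHandleFree_of_shadows`, `threeHandleFreeStablyTrivial_of_shadows`.
* **Escape.** Keep `π₁ = 1` and BOTH pair conditions; arguments insensitive to the group or to one side are dead.

#### B8 · `WaldhausenPairs` (#14592; 4 files) — for a balanced group trisection `K` of `{1}` and `i ≠ j`, ONE `α ∈ Aut S` carries `(Nᵢ, Nⱼ)` onto `(Kᵢ, Kⱼ)`
* **Load-bearing.** `waldhausenPairs_false_without_pairFree`, `…_without_freeQuotient`, `…_without_hypothesis` (LoadBearing.lean),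
  `NormalityLoadBearing.waldhausenPairs_false_without_normal` (slot generated-not-normally-closed witness, `Sym(3)` certificate); `triple`
  is never used; `conclusion_at_standard` (non-vacuity).
* **Refuted strengthenings.** `PairTransferFalse.not_pairTransfer` ("`α(Nᵢ) = Kᵢ ⇒ α(Nⱼ) = Kⱼ`" fails at `S⁴` itself: the Dehn twist
  `b₂ ↦ b₂a₂` fixes `N₀`, moves `N₁` — handlebody group ≠ Heegaard group; the two Leininger–Reid single-kernel standardisations
  cannot be done one at a time), `not_rigid` (`α = 1` pairwise insufficient); `StandardPairSymmetries.not_pairsDetermineThird`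
  (standardising `(K₀, K₁)` does not standardise `K₂`: twist about the shared `a₁`); `exists_swap_s4Kernels`, `crossed_of_pair_zero_one`
  (the ORDERED conclusion is not a mis-statement: the standard pair has a side swap).
* **Position.** Published theorem (Waldhausen on `Hᵢ ∪ Hⱼ ≅ #ᵏ(S¹×S²)`); not refutable mathematically.

#### B9 · `ShadowsStandard` (#14593; 6 files) — every balanced group trisection of `{1}` has standard shadow at every characteristic finite-index level `M` (some `ψ_M`)
* **Load-bearing.** `ShadowLevels.shadowsStandard_false_without_trisection` (`K = ⊥`, `M_{ℤ/2}`), `…_false_without_characteristic`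
  (relabelled standard triple `(N₁,N₂,N₀)` + a non-characteristic index-2 level), `shadowsStandard_without_finiteIndex_iff_unstable`
  (`FiniteIndex` load-bearing but not refutable: without it the statement ≡ unstable standardness of every balanced group trisection of
  `{1}` = SPC4 ∧ balanced 4-d Waldhausen), `shadowsStandard_uniform_iff_unstable` ("one `ψ` for all levels" ≡ unstable standardness);
  `exists_nonstandard_of_not_shadowsStandard` (why it resists: a failure is an exotic `S⁴` or a counterexample to 4-d Waldhausen via AGK Thm 5).
* **Completeness of the invariant.** `HomSets.shadowStandardAt_level_iff` (the `Hom(S,Q)` criterion, both directions).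
* **Line `power-twist-absorption` (mod-`e` gate).** `PowerTwistGate.not_trivialGoeritzAt` (N1: the exact Goeritz factor is load-bearing
  at EVERY `e ≥ 2`, witness `K = T₀ • N`), `not_withoutNormalisationAt` (N2), `not_withoutTrisectionAt` (N3),
  `not_congruenceGateTrivialGoeritz` (N8: the fallback `CongruenceGate` needs it too), `gateAt_iff_noHandlebodyFactorAt` (N6: the
  handlebody factor `c` is decoration), `trivialTwistAt_iff_normalisedUnstableStandardAt`, `gateAt_of_normalisedUnstableStandardAt`
  (sandwich); `GateExponent.forall_gateAt_iff_factorial`, `forall_level_iff_forall_gateAt` (the `∀ e` of `stub_powerTwistGate` is not an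
  over-statement: "some killing exponent per level" ⇔ "every exponent"); `TwistAbsorption.twistAbsorption` — the line's lever, PROVED.

#### B10 · `ShadowApproximation` (#14595; 6 files) — a Waldhausen-normalised balanced group trisection of `{1}` all of whose characteristic finite-index shadows are standard is standard (`Iso N K`)
* **Load-bearing.** `ShadowsOnlyFalse.shadowApproximation_false_without_isGroupTrisection` (and `'`): the junk triple
  `J = (N₀, N₁, N₂ ⊓ ker θ)` (`θ : S₃ → Perm ℤ`) has ALL finite shadows standard WITH THE IDENTITY at every level yet `¬ Iso N J`
  (`not_iso_junk`, `not_iso_of_shadows_only`) — even with slots 0, 1 literally standard; `ShadowsOnlyFalseFields.junk_not_free_quotient_two`,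
  `junk_not_free_pairQuotient_02`: the junk violates exactly FREENESS of `S/K₂` and of the pair `(0,2)` — a proof must USE freeness;
  `π₁ = 1` + normality + level-wise EQUAL shadows do not suffice.
* **Refuted strengthenings ("units never die").** `LevelSymmetriesFalse.not_strongShadowApproximation` (the Artin-style STRONG form —
  every level standardisation is congruent mod `M` to an isomorphism — is false at genus 3), `not_levelSymmetriesLift`, `not_lift_delta`
  (the unit twist `δ = diag(3,2) mod 5` on handle 0 does not lift); `UnitTwistTower.not_lift_deltaT`, `levelSymmetriesLift_fails_cofinally`,
  `not_eventualLevelSymmetriesLift` (no level `M₀` beyond which level symmetries lift: cofinal failure); `Slides.slide01` (the unipotent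
  part of the abelian-level stabiliser DOES lift — the obstruction is exactly the torus of unit scalings).
* **Escape.** Use freeness; do not model the crux on strong Artin approximation; any level-symmetry lifting argument must quotient out units.

#### B11 · `HeegaardHandlebodyCongruenceClosed` (#14596; 6 files) — the gate `P = (Stab N₀ ∩ Stab N₁)·Stab N₂ ⊂ Aut S` is closed in the congruence topology
* **Reading.** `Gate.crux_iff` (literal: `∀ m ρ, (∀ M char. f.i., ρ ∈ P·K_M) → ρ ∈ P`), `heegaardHandlebodyCongruenceClosed_holds_without_finiteIndex`
  (dropping `FiniteIndex` makes it TRIVIAL — all content is in the finite-index restriction); crux OPEN with SPC4 ∧ 4-d-Waldhausen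
  strength on its locus.
* **Refuted strengthenings 1–6.** `OneLevel.heegaardHandlebodyCongruenceClosed_conclusion_not_universal` (S1: `ρ₀ ∉ P`),
  `…_false_with_one_level` (S2: one level — even the mod-2 homology level `M₂` — never suffices), `…_false_with_level_two` (S3),
  `exists_congr_not_inGate` + `…_false_with_any_one_level` (S2′: NO single level suffices; the gate has EMPTY INTERIOR in the congruence
  topology — dihedral certificates along `θ^{2d}`); `JohnsonKernelWitness.not_inGate_rho2` (`ρ₂`, a genus-1 separating twist in the
  Johnson kernel, is outside the gate), `…_false_with_torelli_congruence` (S4), `…_false_with_johnson_congruence` (S5),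
  `…_false_with_classTwo_levels` (S6: the hypothesis over ALL abelian and ALL class-2 nilpotent levels does not imply the conclusion —
  a proof must use class `≥ 3` or non-nilpotent levels). Certificate engines: `not_inGate_of_tripleJoin_ne_top`, `not_inGate_zero_of_cert`.
* **Line `pair-rigidity-retraction`, stub P2.** `FreenessDetectionNeedsManifold.freenessDetection_false_without_heegaardForm` (for EVERY
  rank `k`: "a group with the same finite quotients as `F_k` is free of rank `k`" is false — `F_k × ℚ`; profinite freeness detection is not
  group theory: the Heegaard form `π₁(Hᵢ ∪_θ H₂)` is load-bearing).

#### B12 · `NilpotentShadowsStandard` (#14594; 3 files) — nilpotent (lower-central-series) shadows of balanced group trisections of `{1}` are standard at every class `c`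
* `LoadBearing.nilpotentShadowsStandard_false_without_trisection` (junk `K = ⊤`, `m = 0`, `c = 0`);
  `AnyGroupFalse.nilpotentShadowsStandardAnyGroup_false` (UNCONDITIONAL: `π₁ = 1` is load-bearing already at the ABELIAN level `c = 0`,
  witness `zKernels`; the conditional version via spun lens spaces is `…_of_cyclicTrisection`); `Shape.counterexample_shape`
  (`¬crux` ⇒ a `(3+3m, m+1)` trisection of `{1}` not `Iso` to standard + a threshold class `c₀` — an exotic `S⁴` or a counterexample to
  4-d Waldhausen).

### Route `EntropyRung` (Ricci-flow entropy / shrinker densities; `ν_cyl = log 2 + ½ log π − 3/2`, `Θ(S³×ℝ) = .791`, `Θ(S⁴) = .812`)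

#### B13 · `ChangGurskyYang` (#10834; 6 files) — CGY 2003 Thm A: compact simply connected, `scal > 0`, `∫|W|² < 32π²` ⇒ `≅ S⁴` (a named fact as crux)
* **Load-bearing.** `changGurskyYang_false_without_compact` (punctured round sphere `(ℝ⁴, 96(|y|²+4)⁻²δ)`: `R ≡ 2`, `W ≡ 0`),
  `changGurskyYang_false_without_simplyConnected` (the round `ℝℙ⁴`, even with `[ConnectedSpace]`: exactly CGY's "or `ℝℙ⁴`").
* **Line `margerin-cone-hamilton-rails`, STUB 1 `stub_margerinPolynomial`.** `MargerinPolynomialAsTypedFalse.margerinPolynomialNonpos_asTyped_false`,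
  `…Neg_asTyped_false` (Margerin Prop 4 / Lemma 9 typed over ALL block triples `(A,B,C)` of Hamilton's ODE without SYMMETRY of `A, C`
  is false: witness `A = !![2,0,1;1,1,-1;-1,1,1]`); `MargerinStubOneNegatives.stub_margerinPolynomial_false_without_traceEq` (the Bianchi
  trace identity `tr A = tr C` is load-bearing on its own), `no_uniform_margerinMargin` (no single `σ` on `WP < 1/6`),
  `no_linear_margerinMargin` (margin vanishes QUADRATICALLY in `1/6 − c`); `MargerinMarginBound.margerinMargin_le` (`σ ≤ 2(1−t)²/(3+t²)`),
  `no_margerinMargin_at_sixth`, `no_margerinMargin_above_sixth` (nothing at or above `c = 1/6`: the round cylinder is a double zero of `P₂`);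
  `MargerinStubOneSliceNormalForm.margerinP2_slice_normalForm` (helper normal form on `R = 6`).
* **Escape.** Type curvature operators with their symmetries (symmetric diagonal blocks, Bianchi); margins must be `c`-dependent and `O((1/6−c)²)`.

#### B14 · `CompactShrinkerGap` (#10870; 7 files) — closed `M ≃ₕ S⁴` normalised gradient shrinker with `∫e^{−f} dV > 32π²√π e^{−3/2}` ⇒ (gap conclusion)
* **Load-bearing.** `withoutCompactHomotopy_false` (Gaussian shrinker `(ℝ⁴, δ, |x|²/4)`: closedness is used),
  `potentialLeThree_false_without_compactHomotopy` (the named hypothesis `PotentialLeThree`, `f ≤ 3`, needs closedness: `f(4e₀) = 4`).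
* **Arithmetic ceilings of line `cgy-variance-pivot` (variance budget `D < 2V − 96π²`).** `crzArithmetic_false_at_exp_three_point_one`
  (the Cheng–Ribeiro–Zhou sub-line's arithmetic has ceiling `c* = 3.0807`: `PotentialLeThree` cannot be relaxed to `f ≤ 3.1`),
  `scalarLeArithmetic_false_at_two_point_four_nine` (the `R ≤ c` sub-case has ceiling `c* = 2.4867`, above Koiso–Cao's `R_max = 2.5276`),
  `ScalarToolkitAdmitsViolator.not_budget_of_scalarToolkit` (the printed scalar toolkit (T1)–(T10) on `(V, Z, D, f_max, f_min, R_min)`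
  admits the budget-violating tuple `(95π², 0.99e⁻²·95π², 100π², 4, 1, ½)`: NO arithmetic over printed inequalities proves STUB 1 — the
  single missing scalar is `sup f = sup R`), `weightedIdentities_cannot_bound_variance` (even the exact weighted identities fail without
  `sup f`); `DensityPinning.volume_superlevel_le` / `volume_sublevel_le` (squeeze: a violator has `R_max > 3.08` while `> 85 %` of its
  volume has `f ∈ (3/2, 3)` — variance must come from `R ≪ 2` bulk); `WeylEnergyGurskyLeBrunDeficit.weylEnergy_eq_third_sub`
  (`∫|W|² = ∫R²/3 − 2(V − 32π²)`: exactly `2(V−32π²)` below the two-sided Gursky–LeBrun proportion).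
* **Escape.** A proof of the budget needs a pointwise `sup f` bound (`≤ 3` via CRZ, `≤ 2.48` via Bhatia–Davis) or a genuinely
  non-scalar input.

#### B15 · `NoncompactShrinkerGap` (#10868; 2 files) — complete non-compact non-flat normalised 4-d gradient shrinker ⇒ `∫e^{−f} dV ≤ 32π²√π e^{−3/2}`
* **Every hypothesis load-bearing.** `noncompactShrinkerGap_false_without_nonflat` (Gaussian, `16π² > 124.9`), `…_without_noncompact`
  (round `S⁴(√6)`, `f ≡ 2`: `96π²e⁻² ≈ 128.2`; margin 2.7 %), `…_without_complete` (punctured sphere), `…_without_normalisation` (round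
  cylinder with SHIFTED `f`).
* **Tightness.** `noncompactShrinkerGap_tight_at_cylinder` (`S³(2)×ℝ = (ℝ⁴∖0, 4|y|⁻²δ)`, `f = (log|y|)² + 3/2` ATTAINS the bound),
  `noncompactShrinkerGap_not_strict` (`<` is false), `noncompactShrinkerGap_not_le_nextCompetitor` (constant `(4π)²Θ(S²×ℝ²) = 32π²/e`
  is false: `e < π`).
* **Escape.** Non-strict `≤` with the cylinder constant only; all four hypotheses kept.

#### B16 · `SubcylindricalRecognition` (#10869, the RUNG; 5 files) — closed `M ≃ₕ S⁴` with a PSC metric of entropy `μ ≥ ν_cyl + δ` (all `τ`) ⇒ `≅ S⁴`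
* **Position.** `Shape.spc4_imp` (SPC4-implied: every counterexample is an exotic `S⁴`), `recognition_iff_noExotic` (crux ⇔ no exotic
  `S⁴` carries an `R > 0`, `ν > ν_cyl` metric), `spc4_imp_anyHyp` (SPC4 ⇒ the crux with ANY hypothesis package: NO hypothesis-side
  mutation — drop `R > 0`, drop the entropy clause, non-strict — is refutable short of `¬SPC4`), `withoutMetric_iff_spc4` (drop all metric
  hypotheses = SPC4), `withoutCompact_iff` (the compactness binder is decoration), `recognitionWithoutHomotopyEquiv_false` (junk `M = ∅`).
* **Tightness at `S⁴`.** `RoundSphereTightness.roundSphere_gap_le` (any `c + δ` the round `S⁴` clears is `≤ log 6 − 2`),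
  `not_entropyAbove_round_nuRound` (the round sphere does NOT clear its own density: raising the threshold to `ν_round` loses the model
  witness), `gap_window` (`0.0258 < log 6 − 2 − ν_cyl < 0.0267`); `WindowArithmetic`: certified table
  `Θ(S²×S²) < Θ(ℂℙ²) < Θ_FIK < Θ(S²×ℝ²) < Θ(S³×ℝ) < Θ(S⁴) < 1`, `thetaEinsteinNonround_lt_thetaCyl` (Einstein margin .52),
  `half_lt_thetaCyl` (orbifold models `Θ ≤ 1/2` excluded), `roundSphere_psc` (`R > 0` satisfiable in the tree's typing).
* **Line `ancient-sphere-rigidity`.** `StubBlowdownDecoupling.spc4_imp_blowdownConclusion`, `blowdownConclusion_of_sphereDiffeo` (the Bamler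
  stub `stub_blowdown` is SPC4-trivialisable on its only use: no junk model on `S⁴` refutes it, no case split on `Nonempty (S⁴ ≃ₘ M)` helps);
  `StubBlowdownFloorNoncollapsing.isKappaNoncollapsed_of_muFloor` (a uniform `μ`-floor gives `κ`-noncollapsing at every scale: hypothesis (6)
  of the stub is redundant — no Perelman 4.1 thread needed).

#### B17 · `SubcylindricalExistence` (#10871, ENT; 6 files — the three 2026-08-17 ones (`BlowupExistence`, `SchwarzschildBlowupExistence`, `ConeCoreExistence`) declare ns `Summit.SmoothPoincare4.Cruxes.SubcylindricalExistence.Negative`; 5 dead lines) — every `M ≃ₕ S⁴` carries a metric with `ν(g) ≥ ν_cyl + δ`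
* **Position.** `Logic.psc_of_subcylindricalExistence` (contains PSC-existence on every homotopy 4-sphere — itself open),
  `not_subcylindricalExistence_of_not_spc4` (given the rung B16, an exotic `S⁴` refutes it), `subcylindricalExistence_iff_spc4` (modulo
  the rung and the transported round witness, ENT ⇔ SPC4: SPC4-hard in BOTH directions; the only closable content today is the round
  witness on manifolds KNOWN to be `S⁴`).
* **Exhausted attacks.** `ConstTest.constClause_iff` (the constant-test-function attack is exhausted: the constant clause ⇔ `∫R > 0 ∧
  e^{c+2}·64π²·Vol ≤ (∫R)²`), `entropyClause_nonpos_of_not_integrable` (Bochner junk branch only yields `c ≤ 0`);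
  `Window.nuCyl_lt_nuRound` (`πe < 9`), `margin_gt` / `margin_lt` (`0.026 < ν_round − ν_cyl < 0.0263`: the round witness works with
  `δ = 0.026` and with no `δ ≥ 0.0263`), `nuSheet_lt_nuCyl` (metrics with large `S²(ρ)×D²` regions are no witnesses).
* **Every transfer stub is SPC4-hard given the rung (2026-08-17).** `spc4_of_blowupExistence` / `not_blowupExistence_of_not_spc4` (stub A‴
  `stub_blowupExistence`, exact gauge `b = 0`: SPC4 by positive-mass rigidity alone); `spc4_of_schwarzschildBlowupExistence` /
  `not_schwarzschildBlowupExistence_of_not_spc4` (`Â_b`, flat gauge with mass, via `subcylindricalExistence_of_schwarzschildBlowupExistence`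
  p127092; `S⁴` instance `helper_schwarzschildBlowupExistence_sphereFour`); `spc4_of_coneCoreExistence` / `not_coneCoreExistence_of_not_spc4`
  (`stub_coneCoreExistence`, AVR cone core `c³ > Θ(S³×ℝ)`, via `helper_subcylindricalExistence_of_coneCore` p132897 + the fact
  `sharpLogSobolevAVR_four`, Brendle–Kröncke-type sharp log-Sobolev 2024 Thm 1.1; `S⁴` instance `helper_coneCoreExistence_sphereFour`). Lines
  `green-blowup-conformal-entropy`, `fat-conical-core-avr-logsobolev`, `ekeland-stable-shrinker`, `curvature-dimension-entropy-floor`, `Sketch`: dead.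

### Route `CylinderEntropy` (cross-sections of `N = S⁴×ℝ ⊂ ℝ⁶`, typed cylinder entropy `λ_cyl`)

#### B18 · `CylinderRungTwo` (#7631, R; 2 files) — a homotopy-4-sphere cross-section separating the ends with `λ_cyl < 4/e` is `≅ S⁴`
* **Position.** `CdisproveSandwichRungs.not_spc4_of_not_cylinderRungTwo`, `exotic_of_not_cylinderRungTwo` / `not_cylinderRungTwo_of_exotic`
  (`¬R ⇔` an exotic `S⁴` with a thin cross-section), `target_iff_spc4_of_sliceCalibration` (modulo support `SliceCalibration` #7634, since PROVED, the
  route target `E ∧ R` ⇔ SPC4 — the line is exactly as hard as the summit), `cylinderRungTwo_iff_forall_lt` (strict threshold: the endpoint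
  `≤ 4/e` of CMS Cor 1.5(b) is NOT claimed), `not_cylEntropy_lt_one` (every cross-section has `λ_cyl ≥ 1`: rungs with `c ≤ 1` are
  VACUOUS), `weakenedCrux_twoSlices_false` + `not_cylEntropy_twoSlices_lt` (drop BOTH `M ≃ₕ S⁴` and the entropy bound ⇒ false,
  `S⁴ ⊔ S⁴` as two slices, `λ ≥ 2`).
* **Line `killing-flux`, STUB 2 `FluxIdentity`.** `KillingFluxFluxIdentityLoadBearing.fluxIdentityWithoutContinuous_false`
  (`Continuous ν` cannot be dropped: `±e₅` split along a hemisphere), `fluxIdentityWithoutAbs_false` (the absolute value cannot be dropped).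

#### B19 · `ThinCrossSectionExists` (#7633, E; 1 file) — every `M ≃ₕ S⁴` embeds in `N` as an end-separating cross-section with `λ_cyl < 4/e`
* `FrameAnalysis.false_without_homotopyEquiv` (∅), `false_without_t2` (the branched 4-sphere `Literature.Geometry.Manifold.BranchedFourSphere`),
  `false_without_isManifold` (corrupted atlas `CorruptedAtlasSphere`), `withoutSecondCountable_iff_crux` (droppable),
  `false_at_threshold_le_one` (`λ_cyl ≥ 1` floor), `not_forall_thin` (the `∀ ι` strengthening is false at `S⁴`: fat tilted slice, `λ ≥ 2`),
  `top_weakening` (a TOPOLOGICAL embedding suffices given Freedman + calibration), `crux_of_spc4`, `not_spc4_of_not_crux` (given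
  `SliceCalibration`: a kill is `¬SPC4`).

#### B20 · `SliceIsolation` (#7632; 2 files; line `conformal-kernel-domination`)
* `groundStateContinuity_false_without_area` (STUB `stub_groundStateContinuity` is false without its area hypothesis: two slices
  `S⁴×{0} ∪ S⁴×{c}`), `smallScaleDomination_false_without_slab_of_sliceCalibration` (STUB `stub_smallScaleDomination` false without the
  slab, given `SliceCalibration`), `entropyDomination_false_of_const_lt_of_sliceCalibration` (the constant of `stub_entropyDomination`
  cannot be lowered below `λ(S⁴) = 32/(3e²)`).

### Route `SymplecticOrigami` (origami folds of homotopy 4-spheres; door `(b₁,b₂) = (2,1)`)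

#### B21 · `OrigamiRung` (#7843; 5 files) — fold data on `M ≃ₕ S⁴` ⇒ `M ≅ S⁴` ∨ both pieces are doors
* **Position.** `RefutationCost.not_smoothPoincare4_of_not_origamiRung` (a refutation is an exotic `S⁴`), `strongestRung_iff_smoothPoincare4`
  (the variant with EVERY fold hypothesis and the door escape deleted ⇔ SPC4: the hypotheses are load-bearing for the proof METHOD
  — `b⁺ = 1` SW, adjunction, collar lemma — never for truth modulo the summit), `not_strongestRung_of_not_origamiRung` (sandwich);
  `TwistedSphereProtection.twistedSphere_of_smoothPoincare4` (every stub "`M ≃ₕ S⁴ → data → ∃ φ, IsTwistedSphere 3 φ M`" —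
  `stub_genusZeroEndgame`, `stub_genusZeroTwisted` — is SPC4-implied, cf. A6).
* **Arithmetic core + tightness.** `GenusTable.bettiPinch`, `no_isotropic_pinch`, `genusTable` (only `g = 0` two `b₁ = 0` pieces, `m ∈ {1,2}`,
  or `g = 2` two `b₁ = 2` pieces survive), `door_is_solution` (the door tuple solves EVERY numerical constraint: the escape clause cannot be
  removed by bookkeeping), `conic_case_excluded`; `MeridianPinch.meridian_pinch` (`ℤ/m ⊕ ℤ/m` not cyclic ⇒ `m = 1`: SW-free removal of the
  conic / `K = −H` ghosts), `hantzsche_cyclic`, `swFreeGenusTable`.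
* **Line `pair-rigidity-endgame`.** `PairRigidityMutation.genusFormula_false_without_closed_tuple` (`IsClosedForm` load-bearing in
  `stub_genusFormula`: blown-up Hopf surface tuple), `pinch_chiCount_without_b2_pos` (`b₂ ≥ 1` on BOTH pieces load-bearing in `stub_pinch`),
  `genusFormula_signature_branches`.

#### B22 · `OrigamiFoldExistence` (#7844, E; 7 files) — every `M ≃ₕ S⁴` carries the typed fold data
* **Load-bearing ladder.** `LoadBearing.not_crux_without_homotopyEquiv` (∅; `crux_iff_forall_homotopyEquiv`: it is the ONLY hypothesis),
  `Disconnected.not_crux_without_homotopyEquiv_of_compact_nonempty` (`S⁴ ⊔ S⁴`: CONNECTEDNESS is used; `no_compact_open_subset_of_piece`),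
  `RealProjectiveNotOrientable.not_isOrientable_realProjectiveFour` (ORIENTABILITY rung: `CruxOverClosedConnected` fails at `ℝℙ⁴` given the
  paper theorem `FoldDataForcesOrientable`; paper: `#2(S¹×S³)` shows closed orientable spin `b₂ = 0` is still not enough).
* **Zero slack.** `ZeroSlack.origamiFoldExistence_of_smoothPoincare4`, `not_smoothPoincare4_of_not_origamiFoldExistence` (given
  `RoundSphereIsOrigamiFold` #7845 — since PROVED — a disproof = exotic `S⁴`), `ZeroSlackSharp.not_origamiFoldExistence_of_not_roundSphere` (RS is the
  `M = S⁴` INSTANCE of the crux), `origamiFoldExistence_iff_smoothPoincare4_and_roundSphere` (modulo `OrigamiRung` + `NoGenusTwoDoor`: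
  `E ⇔ SPC4 ∧ RS`).
* **Line `round-trace-continuity`.** `CreaseModels.creaseMeanConvexAt_roundModel` (`3 < 6`: the crease predicates are live and correctly
  signed), `not_creaseMeanConvexAt_id`, `not_isMeanConvexUnwinding_const_id` (roundness of `g 1` alone does not give an unwinding),
  `exists_tangentFrame_orthonormal_image` (the frame quantifier is never vacuous); `MeanConvexUnwindingCreaseGerm` (the fake-ball hypotheses
  supply the `t = 0` clauses of `stub_meanConvexUnwinding`: PATH is not vacuous; `PATHWithoutFakeBall` genuinely contains the stub).
* **Stable-seam reformulation (2026-08-17, `Theorems/SymplecticOrigamiOrigamiFoldExistenceHelperStableSeamOfSmoothPoincare4.lean`).**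
  `helper_stableSeamV2_of_smoothPoincare4`, `helper_smoothPoincare4_iff_stableSeamHostV3`, `helper_origamiFoldExistence_of_stableSeamHostV3`:
  the v3 "stable seam host" stub ⇔ SPC4 — another certified zero-slack apex (§D.1 (iii)).

#### B23 · `NoGenusTwoDoor` (#7842, the door; 4 files; 5 dead lines + re-audits c2–c9) — no closed connected symplectic 4-manifold has `(b₁, b₂) = (2, 1)`
* `NoncompactDoor.noGenusTwoDoor_false_without_compact` (`T*T² ≅ (ℝ²∖0)² ⊂ ℝ⁴` with `dx₀∧dx₁ + dx₂∧dx₃`: compactness load-bearing),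
  `exists_noncompact_door` (the `MForm` hypotheses smooth ∧ closed ∧ non-degenerate are NON-VACUOUS on a tree 4-manifold);
  supports `OpenSubsetConstForm` (constant forms), `RealProjectivePlaneBetti` (`b₀ = 1, b₁ = b₂ = 0` for `ℝℙ²`).
* `CompactDegenerateDoor.noGenusTwoDoor_false_without_nondegenerate`, `exists_compact_degenerate_door` (2026-08-17): the compact `ℝℙ² × S¹ × S¹`
  re-charted on `ℝ⁴` (`Literature.Geometry.Manifold.Rechart`) with the ZERO 2-form has `(b₁, b₂) = (2, 1)` — NON-DEGENERACY is load-bearing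
  (through orientability); closes `proof_wanted false_withoutNondegenerate` of `Disproof.lean` §5. Only the closedness deletion `dω = 0` remains
  uncertified (its witness `(S¹×S³)#(S¹×S³)#ℂℙ²` needs gauge theory to be non-symplectic).

#### B24 · `GromovRecognitionRelEnd` (#11009 = `Literature.Geometry.Symplectic.gromov_recognitionR4_relEnd`, shared crux of `SymplecticOrigami`, `SymplecticCap`, `SullivanDual`; work file `Cruxes/GromovRecognitionRelEnd/Disproof.lean`, 2979 lines, checked; + `Theorems/SymplecticOrigamiGromovRecognitionRelEndStubEndDoesNotReturn*.lean`)
* **Load-bearing table (H1–H10).** `gromovRecognitionRelEnd_false_without_ends` (H5: the shear end of `(ℝ⁴, ω₀)`),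
  `gromovRecognitionRelEnd_false_withCompactK` (H5 weakened to `IsCompact K` is false UNCONDITIONALLY: the standard end itself, `π₂({1<‖z‖}) = 0`
  proved), `…_false_without_pullback` (H10: reflection end), `…_false_without_nondegenerate` (H4), `…_false_without_closed` (H3),
  `…_false_without_smoothForm` (H2; `IsClosedForm` alone with junk `fderiv` carries no regularity), `gromovRecognitionRelEnd_noChi_false_without_smooth`
  (H6 in the `χ`-free form: a `C¹` symplectic shear), `…_false_without_formRegularity` (H2∧H3∧H4 jointly, NON-junk: `M = S⁴`),
  `subsingleton_pi_two_of_conclusion` (H1 forced by the conclusion; droppable iff no blow-up-type model: `…_false_without_pi2_of`),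
  `crux_iff_noChi` (`χ`, H7, H9 redundant).
* **Refuted strengthening.** `not_gromovRecognitionRelEndStrong` (the `∃ K'` of the conclusion cannot be sharpened to `K' = K`: singular
  radial twist end).
* **The compactification attack (§11) and the S-stub.** `M = S⁴` with a stereographic end satisfies H1, H5–H9 and H10 for the
  junk-extended form; `stubEndDoesNotReturn_false_without_pullback`, `…_false_without_smoothForm`, `…_false_without_ends`: the panel's
  common stub "the end does not return" must be the symplectic VOLUME argument — no topological shortcut; `resists`: what remains is
  Gromov 1985 §0.3.C + McDuff–Salamon Rem 4.5.2(viii).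

### Routes `SchoenfliesSplit` (support) / `EuclideanOrigami` (crux)

#### B25 · `SchsplitCerf` (#8758 = `cerf_twistedSphere_four`, crux of `EuclideanOrigami`, support of `SchoenfliesSplit`; 5 files) — every twisted 4-sphere `D⁴ ∪_φ D⁴` is `≅ S⁴` (A6's named fact as a crux)
* **Position.** `RefutationCost.not_smoothPoincare4_of_not_schsplitCerf`, `existsExoticFourSphere_of_not_schsplitCerf` (the interface
  `TwistedSphere 3 φ` has NO junk model: its topology is pinned to `S⁴` by the Alexander trick); `TopologicalGluingCost.not_smoothPoincare4_of_not_topologicalGluing`,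
  `not_topologicalGluing_of_not_schsplitCerf` (even the weakening to continuous injective maps meeting along a HOMEOMORPHISM of `S³` is
  SPC4-implied: the smoothness of the gluing data is load-bearing for the METHOD only).
* **Load-bearing.** `schsplitCerf_false_without_cover` (`S⁴ ⊔ S⁴`; the cover clause = connectedness), `schsplitCerf_false_without_gluing` (∅).
* **Refuted naive strengthenings.** `not_forall_isDiffeotopicToId_sphere_three` (orientation-naive Cerf is false: reflections),
  `not_subsingleton_diffeomorph_sphere_four`, `not_forall_subsingleton_twistedSphere_diffeomorph` ("canonical diffeomorphism" forms are
  false; gluing uniqueness is a genuine theorem).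

### Route `ZeroSurgeryExotic` (negative side: `0`-surgery pairs and the `s`-invariant; MP = Manolescu–Piccirillo 2023)

#### B26 · `ZseThesis` (#0364, target) — ∃ knots `K, K'` with a common `0`-surgery `Y`, `K` smoothly slice, `K'` not
* **Position.** `Position.not_zseThesis_iff_assembly2` (DISPROVING the crux = PROVING the kill switch `Assembly2` "the
  `0`-surgery type determines smooth sliceness"; NOTE 2026-08-16T14:15:59Z: the gate's items-cap autofix DROPPED the route items `Assembly2`
  (#0367), `Assembly3`, `Assembly4` from `Theses/ZeroSurgeryExotic.lean` — the constants are re-declared byte-identically in the record modules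
  `Theorems/ZeroSurgeryExoticAssembly2Record.lean` (def `Assembly2`, OPEN, `zseThesis_iff_not_assembly2`), `…Assembly3.lean`, `…Assembly4.lean`,
  which `Position.lean` / `Shape.lean` now import; `Assembly2` is no longer a staffable item), `zseThesis_false_of_spc4` (SPC4 refutes it: MP Lemma 3.3 PROVED as
  `Literature.Uncategorized.isHomotopyBallSlice_of_zeroSurgeryPair` + the FGMW lemma), `zseThesis_false_of_not_zseHsliceNotSlice`
  (waypoint #0520), `exotic_of_zseThesis` / `not_spc4_of_zseThesis` (a PROOF is an exotic `S⁴`: not junk-provable).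
* **Dead partners / seeds (unconditional unless marked).** `ReverseClosure.zeroSurgeryPair_self_reverse` (`(K, Kʳ, Y)` is always a
  `0`-pair — Livingston's AK-conjecture counterexample in miniature), `zseThesis_reverseWitness_false`, `zseThesis_mirrorReverseWitness_false`
  (reverse and concordance-inverse partners are dead; the whole symmetry group `{K, K̄, Kʳ, K̄ʳ}` of a slice `K` are slice `0`-friends),
  `witness_not_isotopic_symmetries`; `UnknotSeed.zseThesis_unknotSeed_false_of_gabai`, `witness_seed_not_isUnknot_of_gabai` (mod Gabai's
  Property R, DERIVED in friend form `isUnknot_of_zeroSurgeryPair_unknot` by a new cross-model transport of surgery descriptions: the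
  slice knot of a witness must be KNOTTED), `unknotPair_exists` (non-vacuity).

#### B27 · `ZseCruxRasmussen` (#0366 = `Literature.Uncategorized.Crux`) — ∃ `K, K'` common `0`-surgery, `K` smoothly slice, `s(K') ≠ 0`
* **No junk escape.** `Shape.crux_without_slice/_nonzero/_commonSurgery/_surgeryLeft/_surgeryRight` (with ANY one conjunct deleted the
  crux is a THEOREM; `sWitness_inhabited`: `s(T(2,3)) = 2`).
* **Dead strengthenings (mod Rasmussen Thm 1 `eq_zero_of_isSmoothlySlice`).** `crux_false_of_sameKnot`, `crux_false_of_concordant`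
  (Fox–Milnor in tree), `crux_false_of_slicePartner`; `Normalisation.crux_false_of_unknotSeed` (+ Property R friend form);
  `crux_iff_pos`, `crux_iff_two_le`, `crux_iff_le_neg_two`, `Parity.crux_iff_two_le_abs` (sign/size normalisation, unconditional:
  a disproof may assume `s(K') ≥ 2`).
* **Position.** `not_crux_of_mmsw911` (a positive answer to MMSW Question 9.11 kills it — the weakest catalogued killer, OPEN),
  `not_crux_of_zeroSurgeryDeterminesSliceness` / `not_crux_of_assembly2` (the route's kill switch), `not_crux_of_spc4` (SPC4 +
  Rasmussen ⇒ `¬Crux`), `crux_witness_avoids_gluckTwist` (mod MMSW Cor 1.13, A7: the MP sphere of a witness is not a punctured Gluck twist).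
* **Barrier transfers.** `CP2Cost.exoticCP2Sum_of_crux` (GIVEN MMSW §9.3: a witness also yields an exotic `ℂℙ²`-SUM — the price),
  `not_crux_of_cp2Rigid` (`ℂℙ²`-rigidity on homotopy-sphere sums kills the crux), `dissolvesInCP2_of_spc4`; `TopologicalProfile.crux_topologicalWitness_false`
  (mod Freedman: the partner is ALWAYS topologically slice — no topological concordance invariant can certify it, A1),
  `crux_witness_profile`; `BlindInvariants.crux_blindWitness_false` (the crux read through ANY homotopy-ball-blind invariant `ι` —
  `τ, ε, ν⁺, Υ`, the `s♯`-bound, `d`-invariants — is FALSE, A2), `isHomotopyBallBlind_rasmussen_iff_mmsw2023Question911Knot`,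
  `not_crux_of_rasmussen_blind` (the crux ≡ "`s` is not blind on `0`-surgery-born homotopy balls"), the FRIEND LEMMA
  `not_isSmoothlySlice_of_zeroSurgeryPair_of_isConcordant_of_blind` and the `τ`-filter `crux_partner_not_isConcordant_of_blind`
  (the partner is concordant to NO knot with a non-zero blind concordance invariant).

#### B28 · `ZseSVanishesOnPairs` (#0368 = `Literature.Uncategorized.SVanishesOnPairs`) — on every `0`-surgery pair `(K, K')` with `K` smoothly slice, `s(K') = 0`
* **Load-bearing.** `LoadBearing.zseSVanishesOnPairs_false_without_slice/_invariant/_commonSurgery/_surgeryRight/_surgeryLeft`.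
* **Position.** `Position.sVanishesOnPairs_of_spc4` (SPC4 + Rasmussen ⇒ crux), `exotic_of_not_sVanishesOnPairs`, `not_spc4_of_not_sVanishesOnPairs`;
  `ConcordanceFriends.sVanishesOnPairs_iff_not_sliceConcordanceFriend` (mod concordance invariance of `s`: the crux FAILS iff some smoothly
  SLICE `K` has a `0`-friend concordant to a `K₀` with `s(K₀) ≠ 0` — exactly the success condition of Kegel–Spreer's Algorithm 6
  (arXiv:2603.22438): live instances `W₊''` (262 crossings, friend of a knot concordant to `Wh⁺(T₂,₃)`), the `F4/F6` friends below the
  Conway knot's friends), `sVanishesOnPairs_iff_exists_form`.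
* **Dead strengthenings.** `MirrorConsequences.not_rasmussen_zeroSurgeryInvariant` (UNCONDITIONAL: `s` is not a `0`-surgery invariant —
  `S³₀(T(2,3))` is shared by the trefoil and its mirror; no proof via "common `0`-surgery ⇒ equal `s`"), `sVanishesOnPairs_topological_false_of_sDetectsTopSlice`;
  `Strengthenings.zseSVanishesOnPairs_topological_false_of_conwayPair`, `…_sZero_false_of_conwayPair` (the TOPOLOGICAL variant and the
  `s(K) = 0` variant fail at (Conway knot, Piccirillo's `K'`), `s(K') = 2` — conditional on those objects landing),
  `…_framing_false_of_commonSurgery_unknot_trefoil`; `MirrorClosure.sVanishesOnPairs_iff_nonpos/_nonneg` (one inequality suffices).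
* **Line `two-knot-meridional-dual` (Gluck lever) — A7 used positively.** `GluckLeverPosition.gluckLever_of_spc4` (the lever is SPC4-implied),
  `not_spc4_of_not_gluckLever`, `Targets.exoticGluckTwist_of_gluckLever` (what the lever bets), `trefoil_not_sliceInSomeGluckTwist_of_mmsw113`,
  `gluckLever_false_without_slice/_commonSurgery/_surgeryRight/_surgeryLeft_of_mmsw113` (its hypotheses are load-bearing mod Cor 1.13),
  `mmswGluckVanishing_iff_fact` (stub B is verbatim `rasmussen_eq_zero_of_isSliceDiscIn_gluckTwist`).
* **Line `embed-dont-dissolve`.** `HeightZero.isSmoothlySlice_of_isSliceDiscIn_of_punctureEmbeds` (height `n = 0` IS the kill switch),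
  `not_sVanishesOnPairs_witness_not_schoenflies`, `fgmwRasmussenStrategy_sphere_not_schoenflies` (Schoenflies spheres are useless: an
  `s`-witness sphere's puncture never embeds in `S⁴`), `EmbedBetPosition.exists_orientationPreserving_embedding_puncture_of_spc4` (the bet
  is SPC4-implied); `ZeroCharacterised.seed_not_zeroCharacterised_of_not_sVanishesOnPairs` (seeds with a CHARACTERISING `0`-slope are a
  vanishing class), `zeroCharacterised_unknot_of_propertyR`.

### Route `VerlindeRLinks` (NEGATIVE-SIDE route, refutation form; `closes : VrlSlideGap → VrlSliceRigidity → VrlComponentsHBallSlice → ¬ SmoothPoincare4`; GST = Gompf–Scharlemann–Thompson 2010, R-links `L_{n,1} = Q ⊔ Vₙ`)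

#### B29 · `VrlSlideGap` (#16178; 4 files + `Cruxes/VrlSlideGap/{Disproof.lean, STRATEGY-CENSUS(-r1).md, RATTACK-r1.md}`) — some R-link of ≥ 2 components is not STRICTLY handle-slide equivalent to the 0-framed unlink (≡ `¬ StrictGeneralizedPropertyRConjecture`)
* **Load-bearing.** `LoadBearing.trivial_without_rlink / _without_surgeryLink / _without_sphereSum / _without_noSlideClause` (each deletion makes the
  statement a triviality), `two_le_of_witness` (a witness has `n ≥ 2` components: `n = 1` is Gabai), `gap_false_with_kirbyMoves_of` (allowing
  blow-ups / the permissive `IsHandleSlideEquivalent` kills the gap: "blow-ups excluded" is load-bearing, cf. C6), `not_forall_rlink_gap` (not EVERY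
  R-link resists). Calibration: `no_gap_at_zero`, `gap_witness_pos`, `framing_eq_of_isStrictHandleSlideEquivalent_one`,
  `not_equiv_zeroFramedUnlink_of_framing_ne_zero`.
* **Position.** `WitnessRegimes.not_spc4_of_component_not_slice`, `not_spc4_of_exotic_rLinkSphere`, `gap_witness_regimes_slice / _sphere`,
  `gap_iff_exotic_rLinkSphere_of_stdSphereSlides` (granted the partner crux B30 and `hSph`, the gap ⇔ a 1-handle-free exotic `S⁴`);
  `exists_separating_invariant_of_vrlSlideGap` / `invariant_of_equiv` (the "unnamed slide-invariant" skeleton RESTATES the crux — an invariant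
  separating `L` from the unlink exists iff the gap holds; the content is which invariant: Décoppet–Haïoun's char-`p` TL skein certificate, A3 (ii)).
* **Sibling interaction.** `not_akPresentationsACNontrivial_of_sliceRigidity`, `VrlSliceRigidity_false_of_acNontrivial` (with GST's slice
  components `hGST`: the sibling crux B30 is REFUTED modulo the open `AKPresentationsACNontrivial` — the route bets AGAINST Andrews–Curtis
  non-triviality of the AK presentations, i.e. it sits INSIDE A16's conditional no-go rather than evading it).
* **Escape.** A gap certificate must be a genuinely new slide-invariant (zero-divisor carrier, A3); the permissive move set is useless (C6).

#### B30 · `VrlSliceRigidity` (#16179; 3 files + `Cruxes/VrlSliceRigidity/{Disproof.lean, AC-OBSTRUCTION.md, STRATEGY-CENSUS.md}`) — an R-link whose components are slice (in the surgered homotopy ball) IS strictly slide-standard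
* **Load-bearing.** `not_crux_without_isSurgery`, `not_crux_without_sphereSum` (the `(unknot, 1)`-type framing witnesses), `without_slice_iff_strictGPRC`
  (delete sliceness and the crux is verbatim the strict Generalised Property R Conjecture, A16's target).
* **Targets / cost.** `Targets.not_stdSphereSlides_of_acNontrivial`, `sliceSphereStandard_zero_of` (the `Γ₄ = 0` cost of the sphere clause).
* **NEGATIVE-LEMMA HOLD.** `VrlSliceRigidity_false_of_SliceRigidityACObstruction : SliceRigidityACObstruction → ¬ VrlSliceRigidity` with
  `@[conjecture] SliceRigidityACObstruction` (H filed as a construction item; the crux is HELD, not refuted): the crux does NOT evade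
  `StrictPropertyTwoRBarrier` (A16) — given AC-nontriviality of the GST presentations it is false. **Kills.** Any line for B30 that does not
  either refute `AKPresentationsACNontrivial` or restrict the R-links away from the GST family. **Escape.** Restrict to R-links whose
  surgery presentations are AC-trivial by construction (then the crux is a slide-normal-form problem), or move the certificate to B29 alone.

#### B31 · `VrlComponentsHBallSlice` (#15874; 2 files + `Cruxes/VrlComponentsHBallSlice/{Disproof.lean, Lines/kirby_lemma21.lean}`) — components of an R-link are slice in the homotopy 4-ball it presents (GST Prop 2.3: a theorem on paper)
* **Load-bearing (discharged witnesses).** `withoutSurgery_iff`, `vrlComponentsHBallSlice_false_without_surgery_of / _without_sphereSum_of / _uncoupled_of`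
  and their unconditional `_foxMilnor` versions via the trefoil: `torusKnotAlexander_two_three_ne_units_mul_mul_invert` (Fox–Milnor: `Δ_{T(2,3)}`
  is not `f(t)f(t⁻¹)`), `not_isTopologicallySlice_trefoil_of`, `not_isHomotopyBallSlice_trefoil_of` (the `hTop` hypothesis names the TOP input).
* **Position.** `strengtheningSliceInBall_of_spc4` (the strengthening "slice in `B⁴`" is SPC4-implied), `not_strengtheningSliceInBall_of_slideGap_of_sliceRigidity`
  (and is REFUTED by B29 ∧ B30: the route's own cruxes forbid upgrading B31 to `B⁴`-sliceness — the FGMW h-slice/slice gap is exactly the content).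
* **Escape.** None needed (support-grade: Kirby-calculus proof, line `kirby-lemma21`); do not strengthen to `B⁴`.

### Route `WeakReductionDescent` (rev 4; minimal-genus trisections of a fake `S⁴` weakly reduce, then reduce; AZ25 = Aranda–Zupan arXiv:2503.04607; `X_F` = A17)

#### B32 · `DependentTripleAtThree` (#17999; 4 files + `Cruxes/DependentTripleAtThree/{Disproof.lean, BirthAttack.lean}`) — a MINIMAL genus-3 trisection of a homotopy 4-sphere has a dependent (weakly reducing) triple
* **Position.** `not_minimal_three_of_diffeomorph` (under `X ≅ S⁴` genus 3 is never minimal), `not_smoothPoincare4_of_not_dependentTripleAtThree`,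
  `exotic_of_not_dependentTripleAtThree` (a kill is an exotic `S⁴`), `dependentTripleAtThree_iff_noMinimalGenusThree` (mod `X_F` = A17 the crux ⇔
  "no homotopy 4-sphere has minimal genus 3" = the `(3;1,1,1)` frontier of A10 itself).
* **Load-bearing / junk.** `dependentTriple_false_without_trisection` (empty sectors on the round `S⁴`); `HomologicalShadow.shadowTriple_false_threeCP2`
  (`#³ℂℙ²` with its `(3;0,0,0)` trisection: the homological shadow of a dependent triple fails there — the paper's `_false_without_e`),
  `shadowTriple_of_common_class`, `shadowTriple_sphere_threeOneOneOne` (for homotopy spheres homology NEVER obstructs a dependent triple: no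
  homological proof or disproof).
* **Apex.** `StubGtriMorse1121.not_gtriMorse1121_of_not_dependentTripleAtThree`, `not_smoothPoincare4_of_not_stub_gtriMorse1121`, `exotic_of_…`
  (the registered apex is item #0435 `GroupTrisection.GtriMorse1121`, STRICTLY STRONGER than the crux; certificate `dependentTripleAtThree_of_gtriMorse1121`
  p165900); `MinimalityPrice.w3_of_withoutMinimality`, `withoutMinimality_iff_dependentTripleAtThree_and_w3` (dropping "minimal" costs exactly
  `W3` = dependent triples in ALL genus-3 trisections of the standard `S⁴`, AZ25 Question 8.3 — open).
* **Escape.** Keep minimality; any lever must see more than homology (curve-complex / Heegaard-splitting structure of the `(3;1,1,1)` diagram).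

#### B33 · `DependentTripleGenusThreeStandard` (#18000 = `X_F`, AZ25 Thm 1.4 / Cor 1.5; 1 file + `Cruxes/…/{Disproof.lean, BirthAttack.lean}`; `Theorems.dependentTripleGenusThreeStandard_iff_arandaZupan`) — a genus-3 trisected homotopy 4-sphere with a dependent triple is `≅ S⁴`
* **Position.** `not_smoothPoincare4_of_not_dependentTripleGenusThreeStandard` (SPC4-implied), `stub_weaklyReducibleStandard_of_smoothPoincare4`.
* **Refuted stub typings (MSZ range).** `stub_mszClassification_false_with_max` (the `(1;0,1,0)` stabilisation: the printed "max" in the MSZ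
  standardness range is a misprint — typed with `max` the classification stub is FALSE), `stub_mszClassification_false_with_relaxed_range`
  (`(3;1,1,1)` with `min = 1` relaxed: false), `stub_separatingPairReducing_of_noSphere` (the `e`-decoration is needed),
  `stub_loopPartnerNoRange_of_smoothPoincare4_of_presentation`. **Lesson.** Transcribe MSZ/AZ ranges with `min`, both pair conditions and the
  separating/non-separating case split (A17 `_of_msz_of_separating_of_irreducible`).
* **Status.** The item is closed modulo the A17 named fact (`genusThreeBase_iff_az2025` for the sibling `GenusThreeBase` #17910); not a live target.

#### B34 · `MinimalWeaklyReducibleFromFour` (#18019 = `X₂`, genus `≥ 4`; 2 files + `Cruxes/…/{Disproof.lean, BirthAttack.lean, FalsifierGST.md}`) — a minimal trisection of genus `≥ 4` of a homotopy 4-sphere is weakly reducible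
* **Position.** `not_smoothPoincare4_of_not_minimalWeaklyReducibleFromFour` (VACUOUSLY SPC4-implied: under SPC4 no trisection of genus `≥ 1` of a
  homotopy sphere is minimal — `sphere_genusZero_gkTrisection_holds`, `IsGKTrisection.image_diffeomorph'`, `sphere_not_minimal`), `exotic_of_…`,
  `not_minimalWeaklyReducible_of_not_…` (parent K1 `MinimalWeaklyReducible`), `not_noMinimalFromFour_of_not_…`, `noMinimalFromFour_of_smoothPoincare4`.
* **The honest strengthening is 4-d Waldhausen.** `SectorHakenCost.sphere_gkTrisection_three_one`, `sphere_gkTrisection_six_two`,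
  `sectorHaken_hypotheses_satisfiable_sphere` (the apex `stub_sectorHaken`'s hypotheses are met by genus-`≥ 4` trisections OF THE ROUND `S⁴`),
  `sphere_isWeaklyReducible_of_sectorHaken` (so the apex decides weak reducibility of ALL genus-`≥ 4` trisections of `S⁴` — MSZ Conjecture 3.11
  territory, open and "likely false"), `sectorHaken_of_sphere_of_smoothPoincare4`, `sectorHaken_sides_consequences`, `sectorHaken_false_without_trisection`.
* **Escape.** Use minimality non-vacuously (a lever that fails for non-minimal trisections of `S⁴`), or restrict genus (`FalsifierGST.md`: the
  GST/Yeats-type genus-4 designs `S¹ × L(p,q)`-spun are the cheapest test family).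

#### B35 · `WeakReductionReduces` (#17908 = K2; 1 file + `Cruxes/…/{Disproof.lean, BirthAttack.lean, STRATEGY-CENSUS.md, Lines/loop_dichotomy.lean}`) — a weakly reducible minimal trisection of a homotopy 4-sphere is reducible (hence destabilises)
* **Position.** `not_smoothPoincare4_of_not_weakReductionReduces`, `exotic_of_…`, `noMinimalFromFour_iff_smoothPoincare4` (modulo `LowGenusBase`,
  `hThree` and trisection existence the route's descent target ⇔ SPC4 — zero slack, §D.1 (iii)).
* **Refuted weakening.** `withoutMinimal_specialises_to_sphere` — with minimality (`e`) dropped the statement specialises to "every weakly reducible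
  trisection of `S⁴` is reducible", FALSE in print at the `S₂`-spin of `ℝℙ³`-type / `S¹ × L(p,q)` genus-4 designs (witness design recorded; the
  formal counterexample is not in tree). **Escape.** Minimality is load-bearing for truth, not only for method.

### Route `SblfDescent` (broken-genus descent for simplified broken Lefschetz fibrations on `M ≃ₕ S⁴`; `HasSblf M g`; Baykur Lemma 12; hADK = existence of SBLFs)

#### B36 · `RungOne` (#18531; 1 file + `Cruxes/RungOne/{Disproof.lean, EquivalenceAudit.lean, EQUIVALENCE-AUDIT.md, RungOneProbe.lean}`) — a homotopy 4-sphere with a genus-`≤ 1` SBLF is `≅ S⁴`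
* **Position.** `not_smoothPoincare4_of_not_rungOne`; `rungOne_without_sblf_iff_smoothPoincare4` (TYPING ALARM: with the fibration hypothesis
  `HasSblf M 0/1` idle — not consumed by the conclusion's binders — the crux is VERBATIM `SmoothPoincare4`; as typed the SBLF clause is the only
  thing separating it from the summit), `rungOne_iff_smoothPoincare4_of_forall_sblf` (mod "every homotopy sphere has a genus-1 SBLF" the rung ⇔ SPC4),
  `rungOne_without_homotopyEquiv_false_of_witness` (drop `≃ₕ S⁴`: false at `S¹ × S³`-type / non-compact witnesses),
  `isEmpty_diffeomorph_sphere_four_of_not_compactSpace` (junk guard: a non-compact `M` is never `≅ S⁴`).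
* **Escape.** The genus-1 classification (Baykur–Kamada / Hayano) must enter through the SBLF datum; a proof not reading the fibration is a proof of SPC4.

#### B37 · `StepTwo` (#18529; 2 files + `Cruxes/StepTwo/Disproof.lean`) — a genus-2 SBLF on a homotopy 4-sphere can be traded for a genus-`≤ 1` one
* **Position.** `not_smoothPoincare4_of_not_stepTwo` (mod hADK), `strongest_iff_smoothPoincare4` (the strongest form "every `M ≃ₕ S⁴` has a genus-`≤ 1`
  SBLF" ⇔ SPC4 given B36), `not_strongest_of_not_stepTwo`.
* **Dead mechanism: same-map destabilisation.** `SameMapObstruction.genusReading_unique`, `lowerGenus_unique` (the genus of an SBLF is determined by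
  the map), `not_destabilise_inPlace`, `not_sameMap_witness`: the descent MUST change the fibration map (no in-place lowering of the genus of a
  given SBLF) — levers of the form "simplify the monodromy of `f`" without a new map are empty.

#### B38 · `StepGE3` (#18528; 2 files + `Cruxes/StepGE3/{Disproof.lean, STRATEGY-CENSUS.md, Lines/cusp_free_thinning.lean}`; line `Sketch` dead) — genus `≥ 3` SBLFs on homotopy 4-spheres descend to genus `≤ 2`
* **Position.** `genusFlag_unique`; `hasSblf_one_of_stepGE3` / `stepGE3_of_hasSblf_one` (the crux ⇔ "broken genus `≤ 2`" mod Baykur Lemma 12),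
  `stepGE3_of_smoothPoincare4` (mod `sblf_of_every_genus_of_diffeomorph_sphere_four`), `not_smoothPoincare4_of_not_stepGE3`, `descent_of_smoothPoincare4`,
  `stepGE3_without_oneLe_iff` (dropping the `1 ≤ g` guard makes it `StepTwo ∧ StepGE3`).
* **Refuted weakening.** `stepGE3_without_homotopyEquiv_false_of_gap` (drop `≃ₕ S⁴`: false — paper witnesses `S² × Σ_g`, `T⁴ # S¹×S³` have broken
  genus exactly `g ≥ 3`). **Escape.** `≃ₕ S⁴` (indeed `H₂ = 0`) must be consumed by the thinning.

### Route `DottedCircleRasmussen` (rev 18; NEGATIVE-SIDE: FGMW/MMSW dotted-circle slice gaps `DcrGap`, kill switch `DcrRigidity := ¬ DcrGap`; MMSW = Manolescu–Marengon–Sarkar–Willis 2023)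

#### B39 · `DcrGap` (#16128, target; 3 files + `Cruxes/DcrGap/{Disproof.lean, STRATEGY-CENSUS.md}`; line `Sketch` dead "complete modulo an apex no line can supply") — ∃ `k`, a model knot in `∂D_k` slice in some homotopy sphere's `D_k`-complement but in no `S⁴`'s
* **Shape.** `noDisc_iff_forall_not_isModelSliceDisc`, `dcrGap_iff_modelForm`, `dcrRigidity_iff_modelForm` (word-for-word the MMSW model
  `IsModelKnot k` / `IsSliceDiscInComplement k`), `dcrGap_false_without_diffeo` (the "no standard `N ≅ S⁴` carries it" clause is load-bearing),
  `isEmpty_diffeomorph_of_witness` (every witness `Σ` is exotic).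
* **The `k = 0` layer is FGMW.** `KZeroIsFgmw.isSmoothlySlice_of_isHomotopyBallSlice_of_not_dcrGap`, `not_fgmw_of_not_dcrGap` (¬DcrGap ⇒ ¬(FGMW
  h-slice/slice gap) = a positive answer to MMSW Question 9.11 in knot form; so DcrGap is WEAKER than the FGMW gap `ZseHsliceNotSlice` #0520 and
  than B27); `NoEmbedding.not_noDisc_of_isSmoothEmbedding`, `not_isSmoothEmbedding_of_witness` (a witness's punctured `Σ` does not embed in `ℝ⁴`:
  witnesses are NON-INVERTIBLE homotopy spheres). Rung `DcrGapOne` #16129 (`Theorems/DottedCircleRasmussenDcrGapOnePosition.lean`): `iff_model`,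
  `not_smoothPoincare4`, `exists_exotic`, `not_of_smoothPoincare4`, `not_of_dcrRigidity`, `not_iff_rigidityOne` (¬(k=1 rung) is itself open:
  for local knots it is ¬`ZseHsliceNotSlice`), `noDisc_iff_sphere`, `iff_sphereForm`.
* **Barriers.** A2 (the certificate must be `s`, not `τ`/`s♯`), A7 (no witness inside a Gluck twist), A14/FGMW split (below).

#### B40 · `DcrRigidity` (#17014 = `¬ DcrGap`, kill switch; 2 files + `Cruxes/DcrRigidity/Disproof.lean`, `Theorems/DottedCircleRasmussenDcrRigidityApexHardness.lean`)
* **Position.** `not_dcrRigidity_iff(_modelForm)`, `not_spc4_of_not_dcrRigidity`, `exists_exotic_of_not_dcrRigidity`,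
  `exists_nonInvertible_of_not_dcrRigidity(_euclidean)` (a DISPROOF of rigidity needs a NON-INVERTIBLE homotopy sphere — the FGMW split
  SPC4 ⇔ (every homotopy sphere invertible) ∧ (smooth Schoenflies), cf. A14 audit), `not_forall_punctureEmbeds_of_not_dcrRigidity`,
  `not_dcrRigidity_of_isHomotopyBallSlice_not_isSmoothlySlice` (an FGMW knot kills rigidity).
* **Load-bearing / junk.** `LoadBearing.isModelKnot_of_isSliceDiscInComplement`, `not_dcrGap_iff_membershipOnly`, `exists_up_to_homotopyEquiv`,
  `not_dcrGap_iff_roundChart`, `exists_isModelKnot_zero_slice` (non-vacuity of the model at `k = 0`).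
* **Apex hardness.** `helper_apexOfSmoothPoincare4 : SmoothPoincare4 → SchsplitPuncturedEmbeds` (#0371, every homotopy sphere invertible): the
  line's only open stub sits in the sandwich `SPC4 ⇒ SchsplitPuncturedEmbeds ⇒ DcrRigidity ⇒ ¬(FGMW gap)`, all four open — no worker can move it
  short of SPC4-level input (Kirby Problem 4.89 territory).

### Route `DiophantineRotations` (fake 4-spheres cannot rotate: Herman–Yoccoz rigidity two dimensions up; `closes : DiophantineRigidity → QuasiPeriodicExistence → SmoothPoincare4`)

#### B41 · `DiophantineRigidity` (#16607 = K1; 1 file + `Cruxes/DiophantineRigidity/{Lines/birth.lean, STRATEGY-CENSUS.md}`) — a homotopy 4-sphere carrying a Diophantine bi-rotation-type commuting pair of diffeomorphisms is `≅ S⁴`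
* **Summit in costume (certified).** defs `DiophantineRecognition` (K1_rec, the shielded recognition half) and `HermanRigiditySphereFour` (K1_dyn,
  genuine dynamics on the ROUND sphere); `diophantineRigidity_iff` (K1 ⇔ K1_rec ∧ K1_dyn), `spc4_imp_recognition`, `spc4_of_recognition_of_existence`
  (the EQUIVARIANCE of the conjugacy is never used by `closes`), `birotSphere`, `isDiophantinePair_cbrt2` (`τ = 2`, `γ = 1/25`: the Diophantine class
  is inhabited), `spc4_imp_quasiPeriodicExistence` (K2 is SPC4-implied), `recognition_and_existence_iff_spc4`, `target_iff : Target ↔ SmoothPoincare4 ∧ K1_dyn`,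
  `diophantineRigidity_iff_herman_of_spc4`. So the route = SPC4 ∧ (a Herman-type rigidity theorem on `S⁴` that does not feed back).
* **Barrier.** If the commuting pair is upgraded to a genuine smooth `T²`- or `S¹`-action the crux falls to `CircleActionBarrierFour` (A9: already
  standard by Fintushel–Pao, nothing new); if not, the dynamics is decoration. **Escape.** None recorded (STRATEGY-CENSUS: no strategy short of summit).

### Routes `InformationMetricHadamard` / `EinsteinBulk` (Cartan–Hadamard fillings `W⁵` of a homotopy 4-sphere at infinity; shared crux `YamabeExtremalSpheres`)

#### B42 · `AhHadamardFilling` (#6014; 5 files + `Cruxes/AhHadamardFilling/{STRATEGY-CENSUS.md, EQUIVALENCE-AUDIT-q1.md, BC2-PROBES.md, 4 dead lines}`) — every homotopy 4-sphere is the cone-asymptotic sphere at infinity of a complete simply connected `sec ≤ 0` 5-manifold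
* **THE CRUX IS THE SUMMIT (unconditional, certified).** `IffSmoothPoincare4.ahHadamardFilling_iff_smoothPoincare4`, `not_ahHadamardFilling_iff`
  (forward: the route's `closes` fed with the now-PROVED sibling crux `C0AhRecognition` (#6015, `Cruxes.C0AhRecognition.CoreDistanceMorse.C0AhRecognition_of`,
  line `core-distance-morse`, 2026-08-16T21:22Z); backward: `OfSmoothPoincare4.ahHadamardFilling_of_smoothPoincare4` (p119273) with the model
  witness `W = ℍ⁵` in the graph chart of `Literature.Geometry.Riemannian.Hyperboloid.metric ⊤` — file `HyperbolicConeCollar`: `coneCollar_contMDiffOn`,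
  `coneCollar_injOn`, `image_coneCollar`, `isCompact_compl_image_coneCollar`, `metric_coneCollar_eq` (EXACT: `G(dΦ(v,s), dΦ(v,s)) = ‖df v‖²/λ² + s²/(λ²(λ²+1))`),
  `coneCollar_asymptotics`). `not_smoothPoincare4_of_not_ahHadamardFilling`: a refutation is an exotic `S⁴`.
* **Line `Sketch` circular.** `SketchLineCircular.tameFillingNoPi1_iff_smoothPoincare4` (its only open stub X ⇔ SPC4;
  `TameFillingOfSmoothPoincare4.tameFillingNoPi1_of_smoothPoincare4` supplies immersivity `coneCollar_mfderiv_injective` and total convexity of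
  Euclidean chart balls for the hyperbolic distance `norm_le_of_between`, `hessian_negNormSq_neg`), `ahHadamardFilling_iff_smoothPoincare4_of_c0AhRecognition`
  (p121624). Dead lines: `Sketch`, `fisher-sphere-gauss`, `osculating-poisson-collar`, `universal-cover-strips-topology` (each closed modulo an apex
  certified ≡ the crux ≡ SPC4: `stub_coreSign`, `stub_coreSaddleDominance`, `stub_instantonCollarComponentNpc`).
* **Kills.** Every line of this crux and every "filling recognition" thesis whose recognition half is a theorem: the existence half is then
  literally SPC4. **Escape.** None; the item should be read as the summit node of the two routes.

#### B43 · `YamabeExtremalSpheres` (#7998 = Y1, shared by `InformationMetricHadamard` and `EinsteinBulk`; 1 file + `Cruxes/YamabeExtremalSpheres/Lines/Sketch.lean`) — Yamabe-extremal clause for homotopy 4-spheres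
* **Position.** `helper_yamabeClause_sphere`, `yamabeClause_of_diffeomorph_sphere`, `yamabeExtremalSpheres_of_smoothPoincare4 :
  yamabe_roundMetric_sphere_four → SmoothPoincare4 → YamabeExtremalSpheres` (SPC4-implied modulo the named fact that the round metric realises
  `Y(S⁴)`), `…_einsteinBulk_of_smoothPoincare4`, `not_smoothPoincare4_of_not_yamabeExtremalSpheres`. Registered skeleton: `Θ₄ = 0 ∧ Matveyev ∧
  RoundCorkRefill ⇒ Y1` — the cork-refill stub carries everything (A12/A13 class).

### Route `SullivanDual` (rev 13; crux `HyperbolicEnd` #7825 with support `AdmissibleJExists` #7830; line `Sketch` = idea `hyperbolic-crumpling`, dead; live line `taubes-circle-pencil`)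

#### B44 · `HyperbolicEnd` (#7825; 22 files + `Cruxes/HyperbolicEnd/{CertificateRuling.md, Lines/Sketch-dead.md, TRIAGE-r*.md}`) — certificate (`J`, density `F`, `c > 0`: Gauss curvature `≤ -c` along local `J`-curves) ends of punctured homotopy 4-spheres
* **Structural.** `AdmissibleJ.admissibleJExists_of_hyperbolicEnd`, `not_hyperbolicEnd_of_not_admissibleJExists`, `admissibleJExists_of_punctureCertificate`:
  the crux (and stub K2 of `Sketch`) CONTAINS the open support item `AdmissibleJExists` (#7830) verbatim as its first five conjuncts — every closing
  file must build an admissible `J` (standard on a punctured chart ball) on an ARBITRARY homotopy 4-sphere, i.e. trivialise the tangent bundle of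
  the puncture compatibly with the inverted chart (obstruction theory; no statement in tree).
* **REFUTED STUB (the flat filling lemma), twice.** `FrozenFill.helper_frozenFillDim1_false` — the complex-dimension-ONE transcription of
  `stub_certificateFill` with `J` frozen (`= i`) is FALSE: the neck `F(x,v) = (1 + 81/‖x‖⁴)‖v‖²` on `1 < ‖x‖ < 4` is certified with `c = 10⁻³`
  (`NeckDensity.helper_neckDensity`: `Φ₀ΔΦ₀ − |∇Φ₀|² = 1296/q³` exactly and `(q²+81)³ ≤ 648000q³` on `1 < q < 16`; `NeckCertificate.helper_neckCertificate`;
  conformal invariance `CertificatePullback.helper_certificatePullback`: `λΔλ − |∇λ|² = ‖a‖⁶(ΦΔΦ − |∇Φ|²)∘g`) but admits no certified filling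
  (`NeckNotFillable.helper_neckNotFillable`: pull back along `exp`, weighted `Q = Λe^{−s}` equals 6 at `s = log 3`, exceeds 6 inside, is `< 6` near the
  ends — against `ExpWeightTest.helper_expWeightTest`, the Ahlfors-type line tests `DiscLineTest.helper_discLineTest` (`c′Q(w) ≤ 4ρ²`),
  `NeckLineTest.helper_neckLineTest` (`c′Q(w) ≤ α²`), the Schwarz-type bound `LineGrowth.helper_lineGrowth` (`F′(x₀,v) ≤ 16‖v‖²/(c′(R − ‖x₀‖)²)`) and
  `StripMax.helper_frozen_stripMax`). `FrozenFillE4.helper_certificateFill_frozen_false` — the NATIVE statement on `ℝ⁴ = ℂ²` with `J′ := J = J₀` is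
  FALSE: shell witness on `1 < ‖x‖ < 4` (`r₁,r₂,r₃ = 1,2,4`), `F = e^{2ψ_M}‖v‖²`, `ψ_M = −8χ(q₂)log(q₁ + 10⁻³) + Mq₂ + q₁ + q₂`,
  `χ t = smoothTransition((81/100 − t)·25/14)`, `M = 136000C + 1024000C²` (`ShellWitness.helper_frozen_shellWitness` with `c = 2e^{−2(30+16M)}`;
  `HessianBound.helper_frozen_hessianBound` (`J₀`-plurisubharmonicity `H ≥ 2‖v‖²`, `ψ_M ≤ 30 + 16M`); `PsiSlice`, `PsiContDiff`;
  `ProductRule.helper_frozen_productRule`; `ExpRule.helper_frozen_expRule` (`aΔa − |∇a|² = a²Δu` for `a = e^u`); `NormSqDeriv.helper_frozen_normSqDeriv`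
  (Lagrange identity `mΔm − |∇m|² = 4|h₁h₂′ − h₂h₁′|² ≥ 0` for the speed of a `J₀`-line); `LaplacianComp`, `ExpCurve.helper_frozen_expCurve`
  (`G w = (re eʷ)e₀ + (im eʷ)J₀e₀`), `LineGrowthE4.helper_frozen_lineGrowthE4`; `numeric_alpha`: `r = 41/20` vs `13/5`). Ruling: `Cruxes/HyperbolicEnd/CertificateRuling.md`.
* **Kills.** Certificate-filling lemmas with the almost complex structure FROZEN; the freedom `J′ ≠ J` inside the ball is ESSENTIAL (and is where
  Gromov/Taubes-type input must enter). **Escape.** Free `J′` (line `taubes-circle-pencil`); but the `AdmissibleJExists` containment stands for every line.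

### Route `EntropyRung` (cont.; new residue crux of `NoncompactShrinkerGap` B15)

#### B45 · `ConicalGap` (#16589, rank 8; 3 files + `Cruxes/ConicalGap/{Disproof.lean (§(e) Calabi family), STRATEGY-CENSUS.md, SplitGlue.lean}`; line `Sketch` dead) — non-flat complete non-compact normalised 4-d gradient shrinkers with `R → 0` at infinity have `∫e^{−f} ≤ 32π²√π e^{−3/2} = (4π)²Θ(S³×ℝ)`
* **Load-bearing.** `conicalGap_false_without_nonflat` (Gaussian shrinker `(ℝ⁴, δ, |x|²/4)`: `16π² >` bound; decay clause holds with `K = ∅`),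
  `conicalGap_false_without_noncompact` (round `S⁴(√6)`, `f ≡ 2`: the decay clause is vacuous on compact `M`, `K = univ`).
* **The decay clause, exactly.** `DecayClause.conicalGap_decayClause_iff_eventually_cocompact`, `_iff_tendsto_of_nonneg` (for `R ≥ 0` it is `R → 0`
  at infinity, the Munteanu–Wang conical class), `_of_nonpos` (ONE-SIDED: any `R ≤ 0` passes with `K = ∅` — immaterial for complete shrinkers
  (`shrinkerScalarCurvature_nonneg`), but the incomplete Calabi-ansatz Kähler shrinkers `ψ_μ`, `0 < μ < 1`, have `R < 0`, meet every other
  hypothesis and `∫e^{−f} = 16π²e^{2(μ−1)}/μ² > 16π²`: COMPLETENESS is load-bearing through this door), `_of_compactSpace`,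
  `conicalGap_not_decayClause_of_pos_const_le`, `conicalGap_roundCylinderFour_not_decayClause` (`R ≡ 3/2`), `conicalGap_puncturedShrinkingSphereFour_not_decayClause` (`R ≡ 2`).
* **Tightness LOST.** `TightnessLost.conicalGap_excludedExtremiser` (the parent's only extremiser `S³(2)×ℝ` attains the constant exactly and VIOLATES
  the decay clause), `conicalGap_fikDensity_lt_thetaCyl` (best known member FIK on `O(−1) → ℂℙ¹`: `Θ = e^{√2−2}(1+√2)/2 = .672 < .791`, margin 15 %):
  on the conical class the constant is not known sharp; the strict `<` form, "`Θ ≤ 2/e`", even "`Θ ≤ Θ(FIK)`" are UNREFUTED strengthenings (slack for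
  provers; no sharpness witness for refuters). **Escape / note.** The clause is a proof-enabling restriction (Kotschwar–Wang conical rigidity), not a
  certified necessity: dropping it returns B15 (`conicalGap_of_noncompactShrinkerGap`).

### Route `RicciFat` (SPC4 as volume attainment under `Ric ≥ 3`; cork symmetrisation)

#### B46 · `FatBeyondWeylGap` (#18048; 1 file) — `Ric ≥ 3`, volume above the Weyl-gap threshold `8π²/9·…` ⇒ recognition
* `fatBeyondWeylGap_false_without_homotopyEquiv` (the EMPTY manifold: `Vol = 0 <` threshold — §D.2), `nonempty_of_homotopyEquiv_sphere`
  (in ns `…Theorems`: `≃ₕ S⁴` restores non-emptiness). Typing hygiene only; the crux itself is SPC4-shielded (§D.1).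

### Route `TropicalFanoSkeleton` (DRAFT; tropical fake balls collapse)

#### B47 · `TropicalCollapse` (#15643; 1 file + `Cruxes/TropicalCollapse/{StrengthProbes.lean, STRATEGY-CENSUS.md}`) — positive integral tropical fan data on a triangulated `M` force PL-collapse to the standard sphere — MISSTATED (negative-lemma hold)
* `connectedSpace_of_certificate`, `tropicalCollapse_false_of_disconnectedTropicalData : Literature.Topology.FourManifolds.DisconnectedTropicalData → ¬ TropicalCollapse`
  (H = an `S⁴ ⊔ S⁴` datum with `κ = 5` / `κ = 6`; H is NOT constructible today — no `IsSmoothTriangulation` instance in tree — so the item is HELD,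
  its construction item #13643 closed `moot`). **Repair.** Insert `[ConnectedSpace M]` (the §D.2 `S⁴ ⊔ S⁴` witness again). **Kills.** Nothing
  mathematical; recorded so the repaired crux is filed connected.

---

## C. Route-level deaths, on-paper refutations and in-tree refutations of vendored statements

These are the negative results the LEDGER carries for this summit although `ledger negatives --problem SmoothPoincare4` is empty
(no typed statement item has been closed `refuted` — still true 2026-08-17; every informal refutation below could only be recorded as a route
close, a negative-lemma hold, or a dead-line note). Route census 2026-08-17 (`ledger route show`): 5 CLOSED headers unchanged (`PscCorkFillIn`,
`CsArithmeticWalk`, `GluckLasagna`, `InterimWave0`, `LogCYSkeleton`); DRAFT: `TropicalFanoSkeleton` (B47), `LipschitzHauptvermutung` (A1 (d)),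
`CylinderEntropy` (staffable False; B18–B20 unchanged); the rest OPEN.

### C1 · `GluckLasagna` CLOSED 2026-08-15 — skein lasagna modules cannot see Gluck twists
* Route `route-SmoothPoincare4-GluckLasagna` (file kept: `Theses/GluckLasagna.lean`, CLOSED header). Thesis `GlasThesis = ¬ GluckTwistConjecture`
  via a lasagna-module detector. KILL CRITERION 2 fired in print for the posited detector: Ren–Willis 2024 Prop 6.17 (lasagna modules
  over `ℚ` are blind on `ℂℙ²bar`-stably standard homotopy spheres) and Ren–Sullivan–Wedrich–Willis–Zhang 2025 Thm 7.1 (`𝔤𝔩₂` lasagna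
  modules over `ℚ` are Gluck-twist invariant); the sole crux was untypeable (no `skeinLasagnaModule` in tree).
* **Kills.** Technique class "non-semisimple Khovanov-type 4-manifold invariant as a Gluck-twist detector" over `ℚ` — the one
  `evasion_known` that A2/A3 left open is closed for Gluck twists. **Escape.** Other coefficients / other Lie types are not covered by the
  cited theorems; homotopy spheres that are not Gluck twists (A7 escape).

### C2 · `LogCYSkeleton` RETIRED 2026-08-15 — informal crux `NonMax` (#13664) refuted on paper (class: substantive)
* NONMAX asserted: a 5-fold log Calabi–Yau pair whose dual complex is a simply connected closed PL 4-manifold has birational complexity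
  `c_bir < 5` (Mauri–Moraga Problem 1.17, sharpened). Refuter `refuter-rattack-stmt-SmoothPoincare4-13664-0`, ATTACK.md v2: the smooth
  sextic 5-fold `X₆ ⊂ ℙ⁶` with a cusp hyperplane section `D` has `𝒟(X, D) = ∂Δ⁵ ≅_PL S⁴` (simply connected closed PL) and `c_bir = 5`.
  No theorem could land (informal item, no signature), hence `retired` not `refuted`.
* **Kills.** "Run the MMP on a fake 4-sphere": any bridge SPC4 ⇐ REAL ∧ NONMAX; maximal-complexity coregularity-0 pairs with
  `𝒟 ≅ S⁴` exist, so non-maximality cannot be what singles out the standard sphere. **Escape.** None proposed; a NONMAX restricted to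
  dual complexes NOT already known to be `S⁴` is SPC4-shielded (§D.1) and carries no certificate.

### C3 · `InterimWave0` CLOSED 2026-08-15 — the "exotic sphere ⇔ ¬SPC4" bookkeeping is folklore and PROVED
* Sole item #0033 = folklore corollary of Freedman 1982 Thm 1.6; its conditional form is in tree:
  `Literature.Topology.FourManifolds.existsExoticFourSphere_iff_not_forall_nonemptyDiffeomorphSphere_four` (`SPC4Wave0.lean`) and
  `Literature.Barriers.SmoothPoincare4.existsExoticFourSphere_iff_of_freedman` (A1). Not a barrier; recorded so nobody re-files it as a crux.

### C4 · `CsArithmeticWalk`, `PscCorkFillIn` RETIRED 2026-08-15 — `not-a-thesis` (D-0027 §2.1)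
* Their assemblies concluded `Literature.Topology.FourManifolds.CappellShanesonSpheresStandard` resp. `PscAllHomotopySpheres`, not the
  Statement. Structural no-go for planners: a route whose cruxes only reach an intermediate statement (CS spheres standard; PSC on all
  homotopy spheres; `GluckTwistConjecture`; 4-d Waldhausen) is retired unless `closes` reaches `SmoothPoincare4` (or `¬`). The
  mathematics of both lines is reusable as support (CS arithmetic walk: A8; PSC cork fill-in: `PIC`, `WeylBudget`, `IsotropicCorkBracketing`).

### C5 · `TrisectionRefutation` — the FIRST vendoring of trisections was unsatisfiable (in-tree refutation of a named fact)
* `Literature.Topology.FourManifolds.TrisectionRefutation.not_isTrisection`, `not_isBalancedTrisection`, `trisectionGenus_eq_top`,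
  `not_exists_isBalancedTrisection_of`, `not_exists_isBalancedTrisection` (`Literature/Topology/FourManifolds/TrisectionsRefutation.lean`):
  the predicate `IsTrisection X g k S` (sectors = images of smooth embeddings of compact 4-manifolds WITH BOUNDARY meeting pairwise along
  boundaries with a common codimension-2 stratum) is contradictory for every `X` (triple points exist; three pairwise-disjoint open
  half-spaces at a triple point are absurd) — Gay–Kirby's pieces have CORNERS. The named fact `exists_isBalancedTrisection` is
  `@[deprecated]`; replacement `exists_isBalancedGKTrisection` over the corrected `IsGKTrisection` (DISCHARGED, `…_holds`).
* **Kills.** Every statement quantifying over `IsTrisection`/`IsBalancedTrisection` (old `TrisectionFunctor`, `TrisectionEuler`,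
  `SmallTrisections`, the first `GroupTrisection` thesis) is VACUOUS — ex-falso assemblies over it were the reason for the
  `GroupTrisection` v2 rewrite. **Escape.** `IsGKTrisection` (sectors with corners), `msz_homotopySphere_gk` etc. (A10).
* **Lesson (typing).** Decompositions of a closed manifold into codimension-0 pieces meeting along a codimension-2 stratum must be typed
  with corners (or via functions / handle data), never as manifolds-with-boundary.

### C6 · Deprecated / misstated named statements inside the barrier catalogue (do not cite as facts)
* `Literature.Barriers.SmoothPoincare4.gst2010_propertyTwoR_andrewsCurtis`, `PropertyTwoRBarrier` — MISSTATED (stronger than GST 2010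
  §7): stated over the PERMISSIVE `PropertyTwoRConjecture` / `IsHandleSlideEquivalent`, whose generating "slide" can change the surgered
  manifold (`Literature/Topology/FourManifolds/KirbyMoves.lean` Errata); corrected: `StrictPropertyTwoRBarrier` over
  `StrictPropertyTwoRConjecture` (A16). Consequence for routes: the permissive `PropertyTwoRConjecture`, `GeneralizedPropertyRConjecture`
  and `NoOneHandles.NoohGprc` are NOT reached by the Andrews–Curtis invariant at all.
* `RelativeContractibleRigidityFour` — REFUTED as a fact (`not_relativeContractibleRigidityFour`); `ContractibleRigidityFour` — NOT A
  FACT, mis-cited (`not_contractibleRigidityFour`); both kept verbatim only as technique classes of A12.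
* `OpenSubsetUniquenessFour` — NOT A FACT (its negation is what Kirby 1989 XIV prints); kept as the technique class of A14.
* Kronheimer–Mrowka 2013 Cor 1.1 ("`s(K) = 0` for `K` slice in any homotopy 4-ball") — WITHDRAWN in print (`s ≠ s♯`, KM corrigendum 2019;
  `s♯` is not a concordance homomorphism, Gong 2020): may not be cited; the statement is MMSW Question 9.11, registered OPEN as
  `MMSW2023Question911Knot` (A7).

### C7 · `ExoticMirrors` — statements over ALL smooth reflections of `S⁵` are dead on paper (Kervaire mirrors)
* Route header, CHEAPEST FALSIFIER (run 2026-08-15): any crux or card quantifying over all smooth reflections (involutions with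
  codimension-1 fixed set) of `S⁵` is refuted by the Kervaire mirror `F = ∂(D⁵ ∪ 1-handle ∪ 2-handle)` with `π₁(F) = SL(2,5)` — it killed
  the card's step-1 converse and `MIRROR-SEC` / `MIRROR-EXIST` as literally stated; the filed cruxes restrict to mirrors OF HOMOTOPY
  4-SPHERES. Also recorded: `ReflectionSoulRigidity` refuted AS STATED by Lean-level defects (sign convention of `curvatureForm`, junk
  `mfderiv` in `IsIsometry`, empty/disconnected `F`) — a restate, not a mathematical kill (Fang–Grove 2016 not in doubt).
* **Escape.** Quantify over reflections whose fixed set is a homotopy 4-sphere (then SPC4-shielded, §D.1).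

### C8 · Literature-side named conjectures near this summit that are registered OPEN (not facts, not refuted)
* `Literature.Barriers.SmoothPoincare4.FGMWRasmussenStrategy`, `MMSW2023Question911Knot` (negations of each other),
  `AKPresentationsACNontrivial`, `Literature.Topology.FourManifolds.CappellShanesonSpheresStandard`, `GluckTwistConjecture`,
  `StrictPropertyTwoRConjecture` / `StrictGeneralizedPropertyRConjecture`, `Literature.Uncategorized.Crux` (= B27),
  `Literature.Uncategorized.SVanishesOnPairs` (= B28), spc4.S11 `exists_opens_nonempty_homeomorph_isEmpty_diffeomorph_euclideanSpace_four`
  (a THEOREM in print, open only formally). A route leaning on any of these is a conditional bridge or must file it as an item (rule 4b).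

### C9 · Retired-as-redundant lines whose death carries a reusable reason
* `AcyclicBisectionRigidity` round-2 Transfer `DoubleReduction` (B2): a transfer that is SPC4-implied AND equivalent to the crux modulo a
  sibling crux is a COSTUME — triage now fails such transfers summarily.
* `AgkCor6Sufficiency` line `lp-by-sphere-system-surgery` (B6): a lever EQUIVALENT to an existing named fact (Laudenbach–Poénaru) is a new
  proof, not an easier statement.
* `PlanarBisectionRigidity` line `coloured-string-links-square-free-ac` (B5): an engine that only succeeds by producing data from which
  the conclusion is immediate has empty reach.
* `SubcylindricalRecognition` stub `stub_blowdown` (B16), `OrigamiRung` endgame stubs (B21), `ContractibleTwistedDoubleStandard` bet (B3):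
  stubs of the shape `M ≃ₕ S⁴ → data → (conclusion implied by M ≅ S⁴)` are SPC4-trivialisable — they cannot be de-risked by any model on `S⁴`.

### C10 · Dead-line register (`Cruxes/<Crux>/Lines/*-dead.md`, 2026-08-16/17) — the recurring kill is SATURATION
Ninety-odd dead-line notes now sit in the crux workfile directories. Stripped of process records (payload copies "`line-<slug>` = `<slug>`",
"not an eligible line", re-audits), the mathematical reasons fall into four reusable classes — check a new line against them BEFORE registering:
* **(S) Saturated: closed modulo an apex kernel-certified ≡ the crux or ⇐ SPC4 only** (§D.1) — `AhHadamardFilling`: `Sketch`, `fisher-sphere-gauss`,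
  `osculating-poisson-collar`, `universal-cover-strips-topology` (B42); `SullivanDual.Target`: `kaehler-jacket`, `crofton-pencil-laminar-charge`,
  `last-twisted-circle` (handed back, NOT refuted); `DcrGap`: `Sketch` (B39); `ZseCruxRasmussen`: `admissible-witness-sieve`,
  `forced-profile-inversion`, `monodromy-kernel-engine` (apex = a certified crux witness, B27); `ZseSVanishesOnPairs`: `embed-dont-dissolve`,
  `lasagna-difference`, `mirror-double-meridian-class` (B28); `SubcylindricalExistence`: all five lines (B17); `ContractibleTwistedDoubleStandard`:
  `property-r-mazur-halves` at `stub_nonSmallSector` / `stub_gtriMorse1121` (= item #0435), `legendrian-r-knot-rigidity` at `stub_fillingUniqueness`,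
  `legendrian-belt-unlinking` at `stub_beltChirality` (B3); `C0AhRecognition`: `Sketch` (superseded — the crux was then PROVED by `core-distance-morse`);
  `StepGE3`: `Sketch` (class-wise descent, B38); `ConicalGap`: `Sketch` = cards `avr-window` / `avr-density-transform` (B45);
  `NormalFormStablyTrivial`: `Sketch` (B7 position file); `ThinCrossSectionExists`: `ball-mass-slack` ("parked at the summit", ten verifications, B19).
* **(C) Costume by its own kill-switch / residual = the crux** — `ShadowApproximation`: `epi-class-livingston` (dead at `m = 0`),
  `free-shadow-tsystem` (residual `stub_twistLevel` is the crux at `m = 0` verbatim; at `m ≥ 1` `stub_denseFactor` ⇔ the open Nielsen level) (B10);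
  `AcyclicBisectionRigidity`: `Sketch` (not a line: no composition), `branch-two-knot-quotient`, `exchange-recognition`, `seam-duality-cancellation`,
  `minimal-factorisation-rigidity`, `sparse-arrangement-cap`, `szego-relative-index-path`, `folded-curve-branch-locus` (B2, C9).
* **(F) A stub refuted outright** — `HyperbolicEnd`: `Sketch` (frozen-`J` filling lemma false in dim 1 and natively, B44); `PlanarAcyclicBisectionRigidity`
  v3 dictionary stub (B4); `AgkCor6Sufficiency`: `level-set-kirby-triple` at `stub_levelStabilizeOne` (B6); `OrigamiFoldExistence`:
  `bennequin-defect-certificates` at `stub_legendrianNormalForm`, `round-trace-continuity`, `shadow-pleats` (B22); `NoGenusTwoDoor`: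
  `canonical-cap-filling`, `liouville-genus-two-complement`, `weinstein-door-presentation`, `Sketch` (B23); `CompactShrinkerGap`: `cgy-variance-pivot`,
  `decay-climb-numax`, `density-summit-stability` (B14's `sup f` / variance ceilings); `HeegaardHandlebodyCongruenceClosed`: `fine-closure-collapse`,
  `pair-rigidity-retraction`, `unit-defect-dichotomy` (B11).
* **(N) Negative notes that are lemmas in waiting** — `SullivanDual.Target/NEGATIVE-local-cancellation-is-dead.md` (local zero-circle cancellation
  lemmas are dead for #7823); `StepTwo` same-map destabilisation (B37).
Reading: a line whose hardest stub survives (S)/(C) only by being the crux again is not a line (shred/costume lint); (F)-class deaths name the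
exact hypothesis the next skeleton must add.

---

## D. Cross-cutting no-go patterns (read before typing a crux)

### D.1 SPC4-shielding: `∀ M ≃ₕ S⁴, P M → M ≅ S⁴` is unrefutable short of an exotic `S⁴`
Certified instances: `AcyclicBisectionRigidity.Negative.shielded_of_spc4` (for EVERY predicate `P`), and per crux
`acyclicBisectionExists_of_spc4`, `PlanarBisectionRigidity.of_smoothPoincare4`, `CylinderRungTwo.not_spc4_of_not_cylinderRungTwo`,
`ThinCrossSectionExists.crux_of_spc4`, `OrigamiRung.not_smoothPoincare4_of_not_origamiRung`, `origamiFoldExistence_of_smoothPoincare4`,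
`SchsplitCerf.not_smoothPoincare4_of_not_schsplitCerf`, `SubcylindricalRecognition.spc4_imp` / `spc4_imp_anyHyp`,
`subcylindricalExistence_iff_spc4`, `sVanishesOnPairs_of_spc4`, `not_crux_of_spc4` (B27), `zseThesis_false_of_spc4`,
`gluckLever_of_spc4`, `twistedSphere_of_smoothPoincare4`, `rigidityVsSphere_of_smoothPoincare4`, `dissolvesInCP2_of_spc4`; 2026-08-17 additions:
`Spc4ImpliesCrux.crux_of_spc4` (B3), `not_smoothPoincare4_of_not_dependentTripleAtThree` / `…DependentTripleGenusThreeStandard` /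
`…MinimalWeaklyReducibleFromFour` / `…WeakReductionReduces` (B32–B35), `not_smoothPoincare4_of_not_rungOne / _stepTwo / _stepGE3` (B36–B38),
`not_spc4_of_not_dcrRigidity`, `helper_apexOfSmoothPoincare4` (B40), `spc4_imp_recognition`, `spc4_imp_quasiPeriodicExistence` (B41),
`ahHadamardFilling_of_smoothPoincare4` (B42), `yamabeExtremalSpheres_of_smoothPoincare4` (B43), `helper_stableSeamV2_of_smoothPoincare4` (B22),
`strengtheningSliceInBall_of_spc4` (B31).
Consequences. (i) Such a crux has NO cheapest falsifier on the hypothesis side: every `Without…` mutation keeping `M ≃ₕ S⁴ → … → M ≅ S⁴` is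
still SPC4-implied (`spc4_imp_anyHyp`, `strongestRung_iff_smoothPoincare4`, `withoutMetric_iff_spc4`). (ii) Its hypotheses are load-bearing
for the proof METHOD only. (iii) "Zero slack": several route targets are EQUIVALENT to SPC4 modulo their own support items
(`target_iff_spc4_of_sliceCalibration`, `origamiFoldExistence_iff_smoothPoincare4_and_roundSphere`, `subcylindricalExistence_iff_spc4`,
`agkCor6SufficiencyUpTo_zero_iff_smoothPoincare4`, `hCobordismPrinciple_homotopySphere_iff`, `everyHomotopySphereTwisted_iff`; 2026-08-17:
`ahHadamardFilling_iff_smoothPoincare4` (UNCONDITIONAL — the sibling crux got proved, B42), `tameFillingNoPi1_iff_smoothPoincare4`,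
`noMinimalFromFour_iff_smoothPoincare4` (B35), `strongest_iff_smoothPoincare4` (B37), `recognition_and_existence_iff_spc4` / `target_iff` (B41),
`helper_smoothPoincare4_iff_stableSeamHostV3` (B22), `stubs_iff_normalFormStablyTrivial` (B7), `gap_iff_exotic_rLinkSphere_of_stdSphereSlides` (B29)) — a
refuter's grade "restates the target" is then a theorem, and the route's value is entirely in WHY `P` makes `M ≅ S⁴` easier.
(iv) Dually, existence cruxes "every `M ≃ₕ S⁴` carries structure `P`" whose `S⁴` instance holds are SPC4-implied too — a kill is literally
an exotic `S⁴` (`exotic_of_not_acyclicBisectionExists`, `exotic_of_not_cylinderRungTwo`, `exotic_of_not_sVanishesOnPairs`).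
(v) IDLE HYPOTHESES: when the structural hypothesis is not consumed by the conclusion's binders the crux is VERBATIM SPC4
(`rungOne_without_sblf_iff_smoothPoincare4`, B36) or vacuously SPC4-implied (`MinimalWeaklyReducibleFromFour`: under SPC4 no trisection of genus
`≥ 1` is minimal, B34) — the BC7 `crux.hyp-unused` probe exists for this. (vi) When the OTHER crux of a two-crux route gets proved, the remaining
one becomes certified ≡ SPC4 (B42): re-read the route as a one-crux bridge at that moment.

### D.2 The junk / honest witnesses that have already killed deletions here (run each over your signature)
* EMPTY manifold (`PEmpty`, `ChartedSpace.empty`): every `∃`-free universal statement over smooth 4-manifolds without a nonemptiness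
  consequence — `not_crux_without_homotopyEquiv` (B2, B3, B22), `schsplitCerf_false_without_gluing`, `recognitionWithoutHomotopyEquiv_false`,
  `ThinCrossSectionExists.false_without_homotopyEquiv`, `acyclicBisectionExists_false_without_homotopyEquiv`,
  `fatBeyondWeylGap_false_without_homotopyEquiv` (B46, `Vol ∅ = 0`), `dependentTriple_false_without_trisection` (B32),
  `sectorHaken_false_without_trisection` (B34, empty sectors on `S⁴`); NON-COMPACT `M`: `isEmpty_diffeomorph_sphere_four_of_not_compactSpace` (B36).
* `S⁴ ⊔ S⁴` (Mathlib disjoint union; `isSmoothEmbedding_inl_comp` available): connectedness / cover clauses — `not_crux_without_cover` (B3),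
  `schsplitCerf_false_without_cover`, `Disconnected.not_crux_without_homotopyEquiv_of_compact_nonempty` (B22), `weakenedCrux_twoSlices_false` (B18),
  `tropicalCollapse_false_of_disconnectedTropicalData` (B47: a missing `[ConnectedSpace M]`).
* `ℝℙ⁴` (tree `RealProjectiveSpace 4`, round metric, non-orientable: `not_isOrientable_realProjectiveFour`): simple connectivity /
  orientability — `changGurskyYang_false_without_simplyConnected`, B22 orientability rung, `thetaSph_half_lt_thetaCyl`; `ℝℙ² × T²` with the zero
  form (B23: non-degeneracy); `#³ℂℙ²` with its `(3;0,0,0)` trisection (B32: homological shadows); the `(1;0,1,0)` stabilisation and `(3;1,1,1)`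
  with `min = 1` (B33: MSZ ranges); `S² × Σ_g`, `T⁴ # S¹×S³` (B38), `S¹ × S³`-type (B36), `S₂`-spun `ℝℙ³` / `S¹ × L(p,q)` designs (B35: paper
  witnesses against dropping `≃ₕ S⁴` / minimality).
* `ℂℙ²` (`ComplexProjectivePlane`, `H₂ ≅ ℤ`): "closed simply connected" in place of `≃ₕ S⁴` — `not_acyclicBisectionExistsForSimplyConnectedClosed`;
  genus-one trisections `(1,0)` — `UnbalancedFalse`; `S¹×S³ # ℂℙ² # ℂℙ²` (`zKernels`, `χ = 2`, `π₁ = ℤ`) — `AnyGroupFalse` (B6, B7, B12).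
* Branched 4-sphere / corrupted atlas (`Literature.Geometry.Manifold.BranchedFourSphere`, `CorruptedAtlasSphere`): dropping `T2Space` /
  `IsManifold` — B19.
* Geometric models in tree: Gaussian shrinker `(ℝ⁴, δ, |x|²/4)`, round `S⁴(√6)` (`f ≡ 2`), punctured sphere `(ℝ⁴, 96(|y|²+4)⁻²δ)`, round
  cylinder `(ℝ⁴∖0, 4|y|⁻²δ)` with `f = (log|y|)² + 3/2`, tilted/two-slice cross-sections of `S⁴×ℝ`, `T*T² = (ℝ²∖0)²` with a constant symplectic
  form, shear / reflection / radial-twist ends of `(ℝ⁴, ω₀)` — B13–B18, B23, B24; incomplete Calabi-ansatz `U(2)` Kähler shrinkers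
  `0 < μ < 1` (`R < 0`, B45), FIK (B45), frozen-`J` necks `(1 + 81/‖x‖⁴)‖v‖²` and `e^{2ψ_M}‖v‖²` shells (B44), `W = ℍ⁵` cone collar (B42).
* Algebraic junk: `K = ⊤`, `K = ⊥`, relabelled standard triple `N ∘ finRotate 3`, `J = (N₀, N₁, N₂ ⊓ ker θ)`, `F_k × ℚ`, Dehn-twisted standard
  triples `T₀ • N`, `τ • N` — B7–B12.
* Knots / links: unknot, `T(2,3)` (`s = 2` proved; Fox–Milnor non-sliceness B31), mirror / reverse closures — B26–B28; `(unknot, ±1)`-framed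
  one-component links and blow-ups (B29–B30: framing / sphere-sum / surgery clauses, permissive Kirby moves).

### D.3 Typing artefacts seen on this summit (cf. the advisory crux-typing checklist)
* Degree guards (`0 < k` in acyclicity: B1), junk `∫` / non-integrable branches (`entropyClause_nonpos_of_not_integrable`: B17), junk
  `mfderiv`/`fderiv` (`IsClosedForm` alone carries no regularity: B24; `IsIsometry`: C7), decidable-by-`ncard` encodings (empty levels:
  `LensThinSweepouts` kill-criteria note), manifolds-with-boundary vs corners (C5), permissive move sets that change the object
  (`IsHandleSlideEquivalent`: C6), strict vs non-strict thresholds (`cylinderRungTwo_iff_forall_lt`, `noncompactShrinkerGap_not_strict`),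
  hand-picked constants with certified ceilings (`c* = 3.0807`, `2.4867`, `δ < 0.0263`, `4/e`, `λ ≥ 1` floor: B14–B18).
* Orientation-free relational predicates (`IsConnectedSum`, `IsHCobordant`, `IsSliceDiscIn`, `IsIntegralSurgery` are unoriented): mirror
  closures come for free (`pair_mirror`, `IsSliceDiscIn.mirror`, `sVanishesOnPairs_iff_nonpos`), but `ℂℙ²bar` cannot be named (A11 caveat).
* 2026-08-17: ONE-SIDED clauses (`ConicalGap`'s decay clause passes every `R ≤ 0`, B45); missing `[ConnectedSpace M]` (B47); transcribed RANGES
  (`max`/`min` in MSZ standardness, B33); structure predicates that fix too little (`IsPageSystem` up to multitwists, B4; an SBLF hypothesis not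
  consumed by the conclusion, B36); FROZEN auxiliary data where the freedom is the content (`J′ = J`, B44); excluded move sets that are
  load-bearing (`gap_false_with_kirbyMoves_of`, B29); and a harness artefact — the items-cap autofix can drop route decls still referenced by
  landed theorems (B26: re-declare in a `…Record.lean` module, never re-file as items).

### D.4 What is NOT blocked (the recorded escapes, in one list)
Invariants defined at `b₂⁺ = 0` and not sum-stable, stably or h-cobordism invariant (Bauer–Furuta, families, `Pin(2)`; A2–A4); Rasmussen's `s` on
homotopy spheres that do not dissolve in `ℂℙ²` (A7, B27–B28; live print candidates: Kegel–Spreer friends); finite-group symmetry with fixed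
points (A9, A15); trisection genus `≥ 3` with all `kᵢ ≤ g − 2`, starting at `(3;1,1,1)` (A10, B6–B12: must use freeness, both pair
conditions, `π₁ = 1`, levels of nilpotency class `≥ 3`, and quotient out units); `b₂ ≤ 2`-specific rigidity (A11); arguments using
`∂ = S³` / contact common seams / both halves contractible (A12, B3); the weak Generalised Property R with Hopf pairs (A16); compactness-
sensitive recognition of `ℝ⁴` ends with symplectic control (A14, B24); `sup f`-type pointwise inputs for shrinker gaps (B14). 2026-08-17:
strongly irreducible `(3;1,1,1)` trisections (A17, B32); `S²×S²`-ZERO-DIVISOR carriers — lasagna, char-`p` TL skein `Ṡ_{p(2)}` (A3, B29);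
END-sensitive arguments on `Σ ∖ {p}` and the invertibility conjunct (A14, B40); `b₂`-graded rigidity through even / `σ = 0` / definite
families (A11); QC / Lipschitz-category invariants (A1 (d)); free `J′` in certificate fillings (B44); the conical class with completeness used
(B45); minimality used non-vacuously in trisection descent (B34–B35); a new fibration MAP in SBLF descent (B37).

---

## E. Index

### E.1 Barrier decls (§A) → entry
`TopologicalBarrierFour` A1 · `IsHomeomorphismInvariant` A1 · `GaugeSumBarrierFour` A2 · `IsHomotopySphereSumStable` A2 ·
`isZero_singularHomologyZ_two_of_homotopyEquiv` A2 · `StableBarrierFour` A3 · `IsStableInvariant` A3 · `HCobordismInvariantBarrierFour` A4 ·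
`IsHCobordismInvariant` A4 · `HCobordismBarrierFour` A5 · `HCobordismPrincipleFour` A5 · `TwistedSphereBarrierFour` A6 · `ExoticTwistedSphereFour` A6 ·
`GluckTwistCP2Barrier` A7 · `IsCP2Cancellative` A7 · `gluckTwist_connectedSum_complexProjectivePlane` A7 · `rasmussen_eq_zero_of_isSliceDiscIn_gluckTwist` A7 ·
`FGMWRasmussenStrategy` A7/C8 · `MMSW2023Question911Knot` A7/C8 · `DissolvesInCP2` A7 · `mmsw2023_sZero_of_dissolvesInCP2` A7 ·
`CappellShanesonFamilyBarrier` A8 · `CappellShanesonSmallEntryBarrier` A8 · `ExoticCappellShanesonSphere` A8 · `gompf2010_theorem32_d` A8 ·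
`CircleActionBarrierFour` A9 · `ExoticSphereWithCircleActionFour` A9 · `fintushelPao_circleAction_homotopySphere_four` A9 ·
`LowGenusTrisectionBarrier` A10 · `LargeKTrisectionBarrier` A10 · `ExoticTrisectedSphereOfGenusLE` A10 · `msz_homotopySphere_gk` A10 ·
`SmallExoticaBarrier` A11 · `SimplyConnectedRigidityUpTo` A11 · `akhmedovPark2010_exotic_bTwo_three` A11 · `RelativeContractibleBarrierFour` A12 ·
`ContractibleBarrierFour` A12 · `akbulut1991_mazurCork` A12 · `akbulutRuberman2016_theoremB` A12 · `OneStabilisationBarrier` A13 ·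
`kang2022_corollary12` A13 · `OpenAnalogueBarrierFour` A14 · `OpenSubsetUniquenessFour` A14/C6 · `deMichelisFreedman1992_continuum` A14 ·
`ProjectiveRigidityBarrierFour` A15 · `ProjectiveRigidityFour` A15 · `exists_exoticFreeInvolutionQuotient_four` A15 · `StrictPropertyTwoRBarrier` A16 ·
`AKPresentationsACNontrivial` A16/C8 · `PropertyTwoRBarrier` (deprecated) A16/C6 · `TrisectionRefutation.not_isTrisection` C5 ·
`az2025_weaklyReducible_genusThree_homotopySphere_gk` A17 · `Trisection.IsWeaklyReducible` A17 · `topologicalBarrierFour_iff` A1 ·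
`isStableInvariant_of_connectedSum_mul` A3 · `StableBarrierFour.nonempty_diffeomorph_sphere_of_isStableInvariant` A3 · `SimplyConnectedRigidityUpToOn` A11 ·
`not_simplyConnectedRigidityUpToOn_of_akhmedovPark` A11 · `IsSmoothSphereInterior` A14 · `huebschMorse1962_sphereInterior` A14 ·
`openAnalogueBarrierFour_narrow` A14 · `SmoothSchoenfliesConjectureFour` (topic decl) A14 · `kang2022_theorem11` A13.

### E.2 Crux decl (§B) → entry · item · route
AcyclicBisectionExists B1 #10508 ConvexBisection · AcyclicBisectionRigidity B2 #10507 ConvexBisection · ContractibleTwistedDoubleStandard B3 #3546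
ConvexBisection · PlanarAcyclicBisectionRigidity B4 #15086 ConvexBisection · PlanarBisectionRigidity B5 #10511 ConvexBisection · AgkCor6Sufficiency B6
#10894 CongruenceShadows/GroupTrisection · NormalFormStablyTrivial B7 #14591 CongruenceShadows · WaldhausenPairs B8 #14592 CongruenceShadows ·
ShadowsStandard B9 #14593 CongruenceShadows · ShadowApproximation B10 #14595 CongruenceShadows · HeegaardHandlebodyCongruenceClosed B11 #14596
CongruenceShadows · NilpotentShadowsStandard B12 #14594 CongruenceShadows · ChangGurskyYang B13 #10834 EntropyRung · CompactShrinkerGap B14 #10870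
EntropyRung · NoncompactShrinkerGap B15 #10868 EntropyRung · SubcylindricalRecognition B16 #10869 EntropyRung · SubcylindricalExistence B17 #10871
EntropyRung · CylinderRungTwo B18 #7631 CylinderEntropy · ThinCrossSectionExists B19 #7633 CylinderEntropy · SliceIsolation B20 #7632 CylinderEntropy ·
OrigamiRung B21 #7843 SymplecticOrigami · OrigamiFoldExistence B22 #7844 SymplecticOrigami · NoGenusTwoDoor B23 #7842 SymplecticOrigami ·
GromovRecognitionRelEnd B24 #11009 SymplecticOrigami/SymplecticCap/SullivanDual · SchsplitCerf B25 #8758 EuclideanOrigami (crux) + SchoenfliesSplit (support) · ZseThesis B26 #0364 ZeroSurgeryExotic ·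
ZseCruxRasmussen B27 #0366 ZeroSurgeryExotic · ZseSVanishesOnPairs B28 #0368 ZeroSurgeryExotic · VrlSlideGap B29 #16178 VerlindeRLinks ·
VrlSliceRigidity B30 #16179 VerlindeRLinks (HELD) · VrlComponentsHBallSlice B31 #15874 VerlindeRLinks · DependentTripleAtThree B32 #17999
WeakReductionDescent · DependentTripleGenusThreeStandard B33 #18000 WeakReductionDescent · MinimalWeaklyReducibleFromFour B34 #18019
WeakReductionDescent · WeakReductionReduces B35 #17908 WeakReductionDescent · RungOne B36 #18531 SblfDescent · StepTwo B37 #18529 SblfDescent ·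
StepGE3 B38 #18528 SblfDescent · DcrGap B39 #16128 (+ rung DcrGapOne #16129) DottedCircleRasmussen · DcrRigidity B40 #17014 DottedCircleRasmussen ·
DiophantineRigidity B41 #16607 DiophantineRotations · AhHadamardFilling B42 #6014 InformationMetricHadamard · YamabeExtremalSpheres B43 #7998
InformationMetricHadamard/EinsteinBulk · HyperbolicEnd B44 #7825 SullivanDual · ConicalGap B45 #16589 EntropyRung · FatBeyondWeylGap B46 #18048
RicciFat · TropicalCollapse B47 #15643 TropicalFanoSkeleton (HELD, misstated).

### E.3 Technique class → entries
detector / invariant of a would-be exotic `S⁴`: A1 A2 A3 A4 C1 B27 · h-cobordism & stabilisation: A3 A4 A5 A13 · clutching / twisted spheres /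
Schoenflies: A6 B21 B25 · Gluck twists, `s`-invariant, lasagna: A7 C1 B26–B28 · Cappell–Shaneson: A8 C4 · symmetry (`S¹`, `ℤ/2`, reflections):
A9 A15 C7 · trisections / group trisections / Andrews–Curtis: A10 A16 C5 C6 B6–B12 · homeo⇒diffeo rigidity graded by `b₂` / contractible
pieces / corks: A11 A12 A13 B3 · open & end recognition (`ℝ⁴`): A14 B24 · Stein bisections / contact seams: B1–B5 · Ricci-flow entropy, shrinkers,
CGY: B13–B17 B45 · mean curvature flow in `S⁴×ℝ`: B18–B20 · symplectic origami / doors / Gromov recognition: B21–B24 · birational (MMP): C2 ·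
non-semisimple skein / R-links / h-slice: B29–B31 A3 A16 C6 · trisection genus descent: B32–B35 A10 A17 · broken Lefschetz fibrations: B36–B38 ·
dotted circles / FGMW / invertibility: B39–B40 A7 A14 · elliptic dynamics (KAM two dimensions up): B41 A9 · Cartan–Hadamard fillings, Yamabe:
B42–B43 · pseudo-holomorphic certificate ends: B44 A14 · Ricci volume gaps: B46 A11 A12 · tropical / PL collapse: B47 · dead-line classes: C10.

### E.4 Open route → the entries that speak to it (beyond A1/A3/A4/A5/A6, which all positive routes cite as non-applicable)
ConvexBisection: B1–B5, A12 · CongruenceShadows & GroupTrisection: B6–B12, A10, A16, C5 · EntropyRung: B13–B17, A11 · CylinderEntropy: B18–B20 ·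
SymplecticOrigami: B21–B24, A6 · SymplecticCap (blocked, farm): B24, A14 · SullivanDual: B24, A14 · SchoenfliesSplit, EuclideanOrigami: B25, A6 · ZeroSurgeryExotic: B26–B28, A2, A7, C6, C8 ·
DottedCircleRasmussen: A2, A7, A14, B27, B39–B40 (MMSW Q9.11) · VerlindeRLinks: A3 (ii), A7, A16, C6, C8, B29–B31 · WeakReductionDescent: A10, A17,
B32–B35 · SblfDescent: A10, A16, B36–B38 · DiophantineRotations: A9, A15, B41 · InformationMetricHadamard: B42 (≡ SPC4), B43 · EinsteinBulk: B43, A12,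
A13 · SullivanDual: B24, B44, A14 · RicciFat: B46, A11, A12 · TropicalFanoSkeleton (draft): B47, C2 · LipschitzHauptvermutung (draft): A1 (d) ·
SteinHost: A6, A12, A14 · OneStabInvertible: A13, A14 (A), A3 · DissolvableGluck: A7, A13 · ChargedHalfTurns: A2, A9, A15 · OneHandleSplitting:
A9, A13, A3 · SmoothBijectionDefect: A12, A14 · Stabilisation, CommonDualRelay, ThreeFibres, ThreePointSpheres: A3, A5, A13, A12 ·
CyclicSymmetryRung, QuotientSpheres, RealQuotientSpheres, QuaternionicSimilarity, ExoticMirrors: A9, A15, C7 · NoOneHandles, CircularKirby,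
EntropyLadder, RicciTranscript, ConvexityLadder: A16, C6, A10 · TwistorDissolution, TwistorRealLines: A7 (positive use of dissolution) ·
PIC, WeylBudget, IsotropicCorkBracketing, RicciFat, BachCriticalElement, EinsteinBulk: A11, A12, B13 (CGY typing), B16 (entropy windows) ·
EuclideanOrigami, TransparentBalls, SpectralDevelopingMap, SmoothBijectionDefect, ConvexityLadder: A14 · AlgebraicDegree,
CutLocusSpine, WrinkleUnlinking, LensThinSweepouts, MinimalSphereMeanConvex, OneHandleSplitting, HyperbolicTorusFillings, EllipticRuledHost,
LegendrianSphereS7 (conditional bridge), InstantonEntropy, AngleDefectCertificates, CartanHadamardSwindle, SmallBranchSpheres, WeylBudget,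
RealQuotientSpheres (beyond A15), IsotropicCorkBracketing (beyond A11/A12): no entry bites beyond §D.1/§D.2 — their cruxes are SPC4-shielded
rigidity statements; run §D.2.

*End of catalogue. Maintainer: unit `barriers-SmoothPoincare4-l1-g2` (gen 2 of `barriers-SmoothPoincare4-l1`, re-armed daily); sources and
working notes in the seat folder `run/sessions/planner-barriers-SmoothPoincare4-l1-g2-0/folder/` (`NOTES.md`, `BARRIERS.md`, `dump.py`).*

## About this module

This module is the in-tree carrier of the summit's barrier catalogue `BARRIERS.md` (barrier-catalogue
seat, D-0021): the gate's target classes admit no markdown and no docstring-only module under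
`Summits/SmoothPoincare4/`, so the catalogue is published here, next to the catalogued barrier files it
indexes, as the module docstring above plus one kernel-checked anchor (`catalogue_unconditional`).
It introduces no definition and no named fact (D-0026).

## References

[FreedmanGompfMorrisonWalker2010] [KotschickMorganTaubes1995] [ManolescuMarengonSarkarWillis2023]
[KasprowskiPowellRay2023] [RenWillis2024] [ArandaZupan2025] [ReutterSchommerPries2022] [CostantinoEtAl2026]
[HuebschMorse1962] [BaykurHamada2023] [GompfScharlemannThompson2010]
-/

universe u

namespace Literature.Barriers.SmoothPoincare4

/-- **Catalogue anchor (§A of `BARRIERS.md`, unconditional part).** Of the sixteen catalogued barrier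
Props (entries A1–A16; A17 is a named fact, not a barrier Prop) exactly two are theorems of the tree
with every named leaf discharged: the gauge
sum-stability barrier `GaugeSumBarrierFour` (entry A2; Kotschick–Morgan–Taubes 1995 Remark 1 rendered
over the tree fact `isConnectedSum_sphere_self`, discharged) and the Gluck-twist `ℂℙ²` barrier
`GluckTwistCP2Barrier` (entry A7; dissolution `Σ_K # ℂℙ² ≅ ℂℙ²` discharged in
`GluckTwistsDissolveConnectedSumProofs.lean`). The other fourteen hold relative to their cited named
facts (status column of §0.1). No new mathematics: the conjunction of the two `_holds` theorems.
[cite: KotschickMorganTaubes1995, Remark 1] [cite: KasprowskiPowellRay2023, Lemma 3.1] -/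
theorem catalogue_unconditional : GaugeSumBarrierFour.{u} ∧ GluckTwistCP2Barrier.{u} :=
  ⟨GaugeSumBarrierFour_holds, GluckTwistCP2Barrier_holds⟩

end Literature.Barriers.SmoothPoincare4
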